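import Literature.NumberTheory.LFunctions.WeilWindowSuzuki
import Literature.NumberTheory.LFunctions.WeilMarkovQuadratic
import Literature.NumberTheory.LFunctions.WeilDilationVirial
import HarnessLib

/-!
# Small windows of Weil's quadratic form: proof of the asymptotic `λ_a = log(1/a) + μ₁ − log 2π − γ + O(a)`

Sibling proof file of `Literature/NumberTheory/LFunctions/WeilWindowSuzuki.lean` (independent of
`WeilWindowSuzukiProofs.lean`, the proof of the variational part of Thm. 1.4, which landed
concurrently; the four elementary lemmas on the increment form `D_t(g)` that both files need are
kept `private` here). It DISCHARGES the claim `Literature.NumberTheory.LFunctions.Suzuki2026_thm_1_4_asymptotic`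
(M. Suzuki, *Weil's quadratic form via the screw function*, arXiv:2606.09096 (2026), Theorem 1.4,
asymptotic part, p. 4: "`λ_a = log(1/a) + μ₁ − log(2π) + ψ(2) − 1 + O(a)` as `a → 0+`, for some
constant `μ₁ > 0`"), in the tree's normalisation (`λ_a = weilGroundEnergy a`, `ψ(2) − 1 = −γ`):

  `∃ μ₁ > 0, ∃ C a₀, 0 < a₀ ∧ ∀ a ∈ (0, a₀], |ε(a) − (log(1/a) + μ₁ − log 2π − γ)| ≤ C a`

(here with `C = 29`, `a₀ = 1/4`, `μ₁ ≥ 1/12`).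

## The printed proof and this formalisation

Suzuki (§4.2, (4.1)–(4.6); §5.1, (5.1)) rescales the window `[-a, a]` to `[-1, 1]`
(`w(t) = v(at)`), and computes the Rayleigh quotient of `Q_W^a` from the expansion of the screw
function at the origin ((2.2): `g(t) = ½|t| log|t| + A|t| + Σ_{n ≤ e^{|t|}} Λ(n)n^{-1/2}(|t| − log n) + r(t)`,
`A = ½(log 2π − ψ(2))`):

  `R(a, w) = log(1/a) − (2A + 1) + 𝓛(w)/‖w‖² + O(a)`   (`0 < a < ½ log 2`),

with the scale-free jump form `𝓛(w) = ¼ ∬_{(-1,1)²} |w(x) − w(y)|²/|x − y| − ½ ∫ |w|² log(1 − x²)`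
((4.4)); hence `λ_a = log(1/a) + μ₁ − (2A+1) + O(a)` with `μ₁ = inf_{‖w‖=1} 𝓛̄(w)`, and `μ₁ > 0`
by a compactness argument (§5.1: a minimising sequence with `𝓛 → 0` would converge to a constant,
on which the killing term is positive). Note `2A + 1 = log 2π + γ`.

The formalisation follows the same architecture in the tree's toolkit, the screw-function
expansion being replaced by the (already proved) **Markov decomposition** of
`WeilMarkovQuadratic.lean`, `Re Q(g) = P(g) + 𝓔_a(g) − M_a‖g‖₂²` with
`𝓔_a(g) = ∫₀^∞ e^{t/2}/(2 sinh t) · D_t(g) dt` (no primes for `a ≤ 1/4`), `D_t = weilIncrement`: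

* **Key window estimate** (`abs_weilQuadratic_re_sub_jumpForm_le`, = (4.5)/(5.1) before rescaling):
  for `tsupport g ⊆ [-a, a]`, `0 < a ≤ 1/4`,
  `|Re Q(g) − M_a(g) − (log(1/a) − log 4π − γ)‖g‖₂²| ≤ 29 a ‖g‖₂²`, where
  `M_a(g) = ∫_{(0,2a]} D_t(g) dt/(2t)` is the jump form of the window. Ingredients: `|P(g)| ≤ 16a‖g‖²`;
  `D_t = 2‖g‖²` for `t ≥ 2a`; the tail `∫_{2a}^∞ dt/(2 sinh t) = −½ log tanh a = ½ log(1/a) + O(a)`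
  (the antiderivative `½ log tanh(t/2)`); the head `e^{t/2}/(2 sinh t) = 1/(2t) + O(1)` on `(0, 1]`;
  the killing constant `2∫₀^∞ (e^{t/2} − 1)/(2 sinh t)` cancels between `𝓔_a` and `M_a`.
* **Dilation covariance** (`jumpForm_weilDilate`, = (4.1)–(4.2)): `M_a(g) = M_1(g_{a-1})` for the
  unitary dilation `weilDilate` of `WeilDilationVirial.lean`, which maps the unit sphere of the
  window `[-a,a]` onto that of `[-1,1]`. Hence `λ_a = log(1/a) − log 4π − γ + ν + O(a)` with
  `ν = inf {M_1(w) : w ∈ C_c^∞ test, tsupport w ⊆ [-1,1], ‖w‖₂ = 1}` (two-sided `sInf` argument in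
  `Suzuki2026_thm_1_4_asymptotic_holds`), i.e. `μ₁ = ν − log 2` (indeed `M_1 = 𝓛 + (log 2)‖w‖²`,
  see the strip–bulk decomposition below).
* **`μ₁ > 0`, quantitatively** (`jumpForm_window_one_ge`: `M_1(w) ≥ (log 2 + 1/12)‖w‖₂²`), replacing
  the compactness argument: writing `D_t(w) = ∫ |w(u) − w(u − t)|² du` and splitting `u` into the
  strips `u ≤ t − 1`, `u ≥ 1` and the bulk `t − 1 < u < 1` (`weilIncrement_eq_strip_add_bulk`),
  Fubini (`integral_weight_mul_strip`) turns the strips into the killing weight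
  `∫ |w(u)|² (log 2 − ½ log(1 − u²)) du ≥ (log 2)‖w‖² + ½∫u²|w|²` and the bulk into
  `≥ ¼∫₀² C_t dt = ½‖w‖² − ¼|∫w|²` (`∫₀² D_t = 4‖w‖² − |∫w|²`, `integral_Ioc_weilIncrement`); the
  weighted mean inequality `|∫ w|² ≤ (5/3)(‖w‖² + ∫u²|w|²)` (`norm_sq_integral_le_five_thirds`)
  closes the bound. (These are the Lean counterparts of "`𝓛 ≥ 0`, and the killing term is positive
  on constants" in §5.1.)

Everything here is proved; there are no named facts and no new definitions.

## References

* M. Suzuki, *Weil's quadratic form via the screw function*, arXiv:2606.09096 (2026): Thm. 1.4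
  (p. 4); §2.2 (2.2); §4.2 (4.1)–(4.6); §5.1 (5.1). (key `Suzuki2026`)
* E. Bombieri, *Remarks on Weil's quadratic functional in the theory of prime numbers I*, Rend.
  Mat. Acc. Lincei (9) 11 (2000), Thm. 2 (the explicit formula behind the Markov decomposition).
-/

noncomputable section

open Complex Filter Set MeasureTheory
open scoped Real Topology ComplexConjugate ArithmeticFunction.vonMangoldt

namespace Literature.NumberTheory.LFunctions

variable {g : ℝ → ℂ}

/-! ## No prime power enters a window `a ≤ 1/4` -/

/-- For `a ≤ 1/4` every `n ∈ weilPrimeIndex a` (i.e. `log n < 2a ≤ 1/2 < log 2`) has `n ≤ 1`,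
hence `Λ(n) = 0`. [folklore] -/
theorem vonMangoldt_eq_zero_of_mem_weilPrimeIndex {a : ℝ} (ha : a ≤ 1 / 4) {n : ℕ}
    (hn : n ∈ weilPrimeIndex a) : (Λ n : ℝ) = 0 := by
  rw [mem_weilPrimeIndex] at hn
  rcases Nat.lt_or_ge n 2 with h2 | h2
  · interval_cases n <;> simp
  · exfalso
    have hlog : Real.log 2 ≤ Real.log n := Real.log_le_log two_pos (by exact_mod_cast h2)
    have := Real.log_two_gt_d9
    linarith

/-- For `a ≤ 1/4` the prime part of the Dirichlet energy vanishes. [folklore] -/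
theorem weilDirichletEnergy_eq_of_le_quarter {a : ℝ} (ha : a ≤ 1 / 4) (g : ℝ → ℂ) :
    weilDirichletEnergy a g = ∫ t in Ioi (0 : ℝ), weilArchDensity t * weilIncrement g t := by
  unfold weilDirichletEnergy
  rw [Finset.sum_eq_zero fun n hn ↦ by rw [vonMangoldt_eq_zero_of_mem_weilPrimeIndex ha hn]; simp,
    zero_add]

/-- For `a ≤ 1/4` the killing constant is `2 ∫₀^∞ (e^{t/2} − 1)/(2 sinh t) dt + log 4π + γ`. [folklore] -/
theorem weilMarkovConstant_eq_of_le_quarter {a : ℝ} (ha : a ≤ 1 / 4) :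
    weilMarkovConstant a =
      2 * (∫ t in Ioi (0 : ℝ), (Real.exp (t / 2) - 1) / (2 * Real.sinh t)) +
        (Real.log (4 * π) + Real.eulerMascheroniConstant) := by
  unfold weilMarkovConstant
  rw [Finset.sum_eq_zero fun n hn ↦ by rw [vonMangoldt_eq_zero_of_mem_weilPrimeIndex ha hn]; simp]
  ring

/-! ## The increment form of a test function

(Private copies of four elementary lemmas that also appear in `WeilWindowSuzukiProofs.lean`.) -/

/-- `D_t(g) = 2‖g‖₂² − Re (k(t) + k(−t))`, `k = g ⋆ g̃`. [folklore] -/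
private theorem weilIncrement_eq_two_mul_sub_re_add (hg : IsWeilTest g) (t : ℝ) :
    weilIncrement g t = 2 * (∫ x : ℝ, ‖g x‖ ^ 2) -
      (weilConv g (weilReflect g) t + weilConv g (weilReflect g) (-t)).re := by
  rw [weilConv_weilReflect_add_neg hg t, Complex.ofReal_re]
  ring

/-- `t ↦ D_t(g)` is continuous for a test function `g`. [folklore] -/
private theorem weilIncrement_continuous (hg : IsWeilTest g) : Continuous (weilIncrement g) := by
  have hk : Continuous (weilConv g (weilReflect g)) := (hg.weilConv hg.weilReflect).1.continuous
  have : weilIncrement g = fun t ↦ 2 * (∫ x : ℝ, ‖g x‖ ^ 2) -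
      (weilConv g (weilReflect g) t + weilConv g (weilReflect g) (-t)).re :=
    funext (weilIncrement_eq_two_mul_sub_re_add hg)
  rw [this]
  fun_prop

/-- `D_t(g) ≤ 4‖g‖₂²`. [folklore] -/
private theorem weilIncrement_le_four_mul (hg : IsWeilTest g) (t : ℝ) :
    weilIncrement g t ≤ 4 * ∫ x : ℝ, ‖g x‖ ^ 2 := by
  rw [weilIncrement_eq_two_mul_sub_re_add hg t]
  have h1 := norm_weilConv_weilReflect_le hg t
  have h2 := norm_weilConv_weilReflect_le hg (-t)
  have h3 : -(‖weilConv g (weilReflect g) t‖ + ‖weilConv g (weilReflect g) (-t)‖) ≤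
      (weilConv g (weilReflect g) t + weilConv g (weilReflect g) (-t)).re := by
    have := Complex.abs_re_le_norm (weilConv g (weilReflect g) t + weilConv g (weilReflect g) (-t))
    have := norm_add_le (weilConv g (weilReflect g) t) (weilConv g (weilReflect g) (-t))
    have := neg_abs_le (weilConv g (weilReflect g) t + weilConv g (weilReflect g) (-t)).re
    linarith
  linarith

/-- Beyond the window the increment is constant: `D_t(g) = 2‖g‖₂²` for `2a ≤ |t|` when
`tsupport g ⊆ [-a, a]`. [folklore] -/
private theorem weilIncrement_eq_two_mul_of_le_abs (hg : IsWeilTest g) {a : ℝ} (hsupp : tsupport g ⊆ Icc (-a) a)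
    {t : ℝ} (ht : 2 * a ≤ |t|) : weilIncrement g t = 2 * ∫ x : ℝ, ‖g x‖ ^ 2 := by
  rw [weilIncrement_eq_two_mul_sub_re_add hg t, weilConv_weilReflect_eq_zero_of_le_abs hg hsupp ht,
    weilConv_weilReflect_eq_zero_of_le_abs hg hsupp (by rwa [abs_neg])]
  simp

/-! ## The archimedean density near `0`: `e^{t/2}/(2 sinh t) = 1/(2t) + O(1)` -/

/-- `|sinh t − t| ≤ t²` for `|t| ≤ 1`. [folklore] -/
theorem abs_sinh_sub_le {t : ℝ} (ht : |t| ≤ 1) : |Real.sinh t - t| ≤ t ^ 2 := by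
  have h1 := Real.abs_exp_sub_one_sub_id_le ht
  have h2 := Real.abs_exp_sub_one_sub_id_le (x := -t) (by rwa [abs_neg])
  rw [Real.sinh_eq]
  have e : (Real.exp t - Real.exp (-t)) / 2 - t =
      ((Real.exp t - 1 - t) - (Real.exp (-t) - 1 - -t)) / 2 := by ring
  rw [e, abs_div, abs_two]
  have := abs_sub (Real.exp t - 1 - t) (Real.exp (-t) - 1 - -t)
  have e2 : (-t) ^ 2 = t ^ 2 := by ring
  rw [e2] at h2
  linarith

/-- On `(0, 1]`: `|e^{t/2}/(2 sinh t) − 1/(2t)| ≤ 1`. [folklore] -/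
theorem abs_weilArchDensity_sub_le {t : ℝ} (ht0 : 0 < t) (ht1 : t ≤ 1) :
    |weilArchDensity t - 1 / (2 * t)| ≤ 1 := by
  have hs : 0 < Real.sinh t := Real.sinh_pos_iff.2 ht0
  have hst : t ≤ Real.sinh t := Real.self_le_sinh_iff.2 ht0.le
  have h1 := abs_sinh_sub_le (t := t) (by rw [abs_of_pos ht0]; exact ht1)
  have h2 := Real.abs_exp_sub_one_sub_id_le (x := t / 2) (by rw [abs_of_pos (by positivity)]; linarith)
  have hnum : |t * Real.exp (t / 2) - Real.sinh t| ≤ 2 * t * Real.sinh t := by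
    rw [abs_le] at h1 h2 ⊢
    constructor <;> nlinarith [h1.1, h1.2, h2.1, h2.2, ht0, ht1, hst]
  have e : weilArchDensity t - 1 / (2 * t) =
      (t * Real.exp (t / 2) - Real.sinh t) / (2 * t * Real.sinh t) := by
    unfold weilArchDensity
    field_simp
  rw [e, abs_div, abs_of_pos (by positivity : 0 < 2 * t * Real.sinh t), div_le_one (by positivity)]
  exact hnum

/-! ## The tail of the archimedean density: `∫_{2a}^∞ dt/(2 sinh t) = −½ log tanh a` -/

/-- The antiderivative `G(t) = ½ (log sinh(t/2) − log cosh(t/2))` of `1/(2 sinh t)` on `(0, ∞)`. [folklore] -/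
theorem hasDerivAt_half_log_tanh_half {t : ℝ} (ht : 0 < t) :
    HasDerivAt (fun t ↦ (1 / 2 : ℝ) * (Real.log (Real.sinh (t / 2)) - Real.log (Real.cosh (t / 2))))
      (1 / (2 * Real.sinh t)) t := by
  have hs : 0 < Real.sinh (t / 2) := Real.sinh_pos_iff.2 (by positivity)
  have hc : 0 < Real.cosh (t / 2) := Real.cosh_pos _
  have hs' : HasDerivAt (fun t : ℝ ↦ Real.sinh (t / 2)) (Real.cosh (t / 2) * (1 / 2)) t :=
    ((hasDerivAt_id t).div_const 2).sinh
  have hc' : HasDerivAt (fun t : ℝ ↦ Real.cosh (t / 2)) (Real.sinh (t / 2) * (1 / 2)) t :=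
    ((hasDerivAt_id t).div_const 2).cosh
  have h1 : HasDerivAt (fun t ↦ Real.log (Real.sinh (t / 2)))
      (Real.cosh (t / 2) * (1 / 2) / Real.sinh (t / 2)) t := hs'.log hs.ne'
  have h2 : HasDerivAt (fun t ↦ Real.log (Real.cosh (t / 2)))
      (Real.sinh (t / 2) * (1 / 2) / Real.cosh (t / 2)) t := hc'.log hc.ne'
  have h : HasDerivAt
      (fun t ↦ (1 / 2 : ℝ) * (Real.log (Real.sinh (t / 2)) - Real.log (Real.cosh (t / 2))))
      ((1 / 2 : ℝ) * (Real.cosh (t / 2) * (1 / 2) / Real.sinh (t / 2) -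
        Real.sinh (t / 2) * (1 / 2) / Real.cosh (t / 2))) t :=
    (h1.fun_sub h2).const_mul (1 / 2 : ℝ)
  refine h.congr_deriv ?_
  have hsinh : Real.sinh t = 2 * Real.sinh (t / 2) * Real.cosh (t / 2) := by
    rw [← Real.sinh_two_mul]; congr 1; ring
  have hsq : Real.cosh (t / 2) ^ 2 - Real.sinh (t / 2) ^ 2 = 1 := Real.cosh_sq_sub_sinh_sq _
  rw [hsinh]
  field_simp
  nlinarith [hsq]

/-- `sinh x / cosh x → 1` as `x → ∞`. [folklore] -/
theorem tendsto_log_sinh_sub_log_cosh_atTop :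
    Tendsto (fun t : ℝ ↦ (1 / 2 : ℝ) * (Real.log (Real.sinh (t / 2)) - Real.log (Real.cosh (t / 2))))
      atTop (𝓝 0) := by
  -- `log sinh x − log cosh x = log (1 − q) − log (1 + q)` with `q = e^{-2x} → 0`
  have hq : Tendsto (fun t : ℝ ↦ Real.exp (-t)) atTop (𝓝 0) := by
    simpa using Real.tendsto_exp_neg_atTop_nhds_zero
  have hlog1 : Tendsto (fun t : ℝ ↦ Real.log (1 - Real.exp (-t))) atTop (𝓝 0) := by
    have h := (tendsto_const_nhds (x := (1 : ℝ))).sub hq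
    rw [sub_zero] at h
    have := (Real.continuousAt_log one_ne_zero).tendsto.comp h
    simpa [Function.comp_def] using this
  have hlog2 : Tendsto (fun t : ℝ ↦ Real.log (1 + Real.exp (-t))) atTop (𝓝 0) := by
    have h := (tendsto_const_nhds (x := (1 : ℝ))).add hq
    rw [add_zero] at h
    have := (Real.continuousAt_log one_ne_zero).tendsto.comp h
    simpa [Function.comp_def] using this
  have h := (hlog1.sub hlog2).const_mul (1 / 2 : ℝ)
  simp only [sub_zero, mul_zero] at h
  refine h.congr' ?_
  filter_upwards [eventually_gt_atTop 0] with t ht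
  have he : 0 < Real.exp (t / 2) := Real.exp_pos _
  have hs : Real.sinh (t / 2) = Real.exp (t / 2) * (1 - Real.exp (-t)) / 2 := by
    rw [Real.sinh_eq, mul_sub, mul_one, ← Real.exp_add]
    congr 1; ring_nf
  have hc : Real.cosh (t / 2) = Real.exp (t / 2) * (1 + Real.exp (-t)) / 2 := by
    rw [Real.cosh_eq, mul_add, mul_one, ← Real.exp_add]
    congr 1; ring_nf
  have h1 : 0 < 1 - Real.exp (-t) := by
    have : Real.exp (-t) < 1 := Real.exp_lt_one_iff.2 (by linarith)
    linarith
  have h2 : 0 < 1 + Real.exp (-t) := by positivity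
  rw [hs, hc, Real.log_div (by positivity) two_ne_zero, Real.log_div (by positivity) two_ne_zero,
    Real.log_mul he.ne' h1.ne', Real.log_mul he.ne' h2.ne']
  ring

/-- **The tail integral**: for `a > 0`, `t ↦ 1/(2 sinh t)` is integrable on `(2a, ∞)` and
`∫_{2a}^∞ dt/(2 sinh t) = −½ (log sinh a − log cosh a) = −½ log tanh a`. [folklore] -/
theorem integral_Ioi_inv_two_sinh {a : ℝ} (ha : 0 < a) :
    IntegrableOn (fun t : ℝ ↦ 1 / (2 * Real.sinh t)) (Ioi (2 * a)) ∧
      ∫ t in Ioi (2 * a), 1 / (2 * Real.sinh t) =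
        -((1 / 2 : ℝ) * (Real.log (Real.sinh a) - Real.log (Real.cosh a))) := by
  have hcont : ContinuousWithinAt
      (fun t ↦ (1 / 2 : ℝ) * (Real.log (Real.sinh (t / 2)) - Real.log (Real.cosh (t / 2))))
      (Ici (2 * a)) (2 * a) :=
    (hasDerivAt_half_log_tanh_half (by positivity : (0 : ℝ) < 2 * a)).continuousAt.continuousWithinAt
  have hderiv : ∀ t ∈ Ioi (2 * a), HasDerivAt
      (fun t ↦ (1 / 2 : ℝ) * (Real.log (Real.sinh (t / 2)) - Real.log (Real.cosh (t / 2))))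
      (1 / (2 * Real.sinh t)) t := fun t ht ↦
    hasDerivAt_half_log_tanh_half (lt_trans (by positivity) (mem_Ioi.1 ht))
  have hpos : ∀ t ∈ Ioi (2 * a), 0 ≤ 1 / (2 * Real.sinh t) := fun t ht ↦
    div_nonneg zero_le_one (mul_nonneg zero_le_two
      (Real.sinh_pos_iff.2 (lt_trans (by positivity) (mem_Ioi.1 ht))).le)
  refine ⟨integrableOn_Ioi_deriv_of_nonneg hcont hderiv hpos tendsto_log_sinh_sub_log_cosh_atTop, ?_⟩
  rw [integral_Ioi_of_hasDerivAt_of_nonneg hcont hderiv hpos tendsto_log_sinh_sub_log_cosh_atTop]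
  have : 2 * a / 2 = a := by ring
  rw [this]
  ring

/-- `sinh a ≤ a e^a` for `0 ≤ a ≤ 1`. [folklore] -/
theorem sinh_le_mul_exp {a : ℝ} (ha0 : 0 ≤ a) (ha1 : a ≤ 1) : Real.sinh a ≤ a * Real.exp a := by
  have h1 := abs_sinh_sub_le (t := a) (by rwa [abs_of_nonneg ha0])
  have h2 : 1 + a ≤ Real.exp a := by linarith [Real.add_one_le_exp a]
  rw [abs_le] at h1
  nlinarith [h1.2, mul_le_mul_of_nonneg_left h2 ha0]

/-- **The tail constant is `log(1/a) + O(a)`**: for `0 < a ≤ 1`,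
`|−(log sinh a − log cosh a) − log(1/a)| ≤ a` (`a e^{-a} ≤ tanh a ≤ a`… in the form
`e^{-a} ≤ a cosh a / sinh a ≤ e^{a}`). [folklore] -/
theorem abs_neg_log_tanh_sub_log_inv_le {a : ℝ} (ha0 : 0 < a) (ha1 : a ≤ 1) :
    |-(Real.log (Real.sinh a) - Real.log (Real.cosh a)) - Real.log (1 / a)| ≤ a := by
  have hs : 0 < Real.sinh a := Real.sinh_pos_iff.2 ha0
  have hc : 0 < Real.cosh a := Real.cosh_pos _
  have hsa : a ≤ Real.sinh a := Real.self_le_sinh_iff.2 ha0.le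
  have hce : Real.cosh a ≤ Real.exp a := by
    rw [Real.cosh_eq]
    have : Real.exp (-a) ≤ Real.exp a := Real.exp_le_exp.2 (by linarith)
    linarith
  have hc1 : 1 ≤ Real.cosh a := Real.one_le_cosh a
  have hse : Real.sinh a ≤ a * Real.exp a := sinh_le_mul_exp ha0.le ha1
  -- the quantity is `log (a cosh a / sinh a)`
  have e : -(Real.log (Real.sinh a) - Real.log (Real.cosh a)) - Real.log (1 / a) =
      Real.log (a * Real.cosh a / Real.sinh a) := by
    rw [Real.log_div (by positivity) hs.ne', Real.log_mul ha0.ne' hc.ne', one_div, Real.log_inv]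
    ring
  rw [e, abs_le]
  constructor
  · -- `e^{-a} ≤ a cosh a / sinh a`
    have h : Real.exp (-a) ≤ a * Real.cosh a / Real.sinh a := by
      rw [le_div_iff₀ hs, Real.exp_neg]
      have : (Real.exp a)⁻¹ * Real.sinh a ≤ a := by
        rw [inv_mul_le_iff₀ (Real.exp_pos a)]
        linarith [mul_comm a (Real.exp a)]
      nlinarith
    have := Real.log_le_log (Real.exp_pos _) h
    rwa [Real.log_exp] at this
  · have h : a * Real.cosh a / Real.sinh a ≤ Real.exp a := by
      rw [div_le_iff₀ hs]
      nlinarith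
    have := Real.log_le_log (by positivity) h
    rwa [Real.log_exp] at this

/-! ## The pole form is `O(a) ‖g‖₂²` -/

/-- For `tsupport g ⊆ [-a, a]`, `0 < a ≤ 1`: `|P(g)| ≤ 16 a ‖g‖₂²`
(`P(g) = 2 Re(ĝ(0) conj ĝ(1))`, `|ĝ(0)|, |ĝ(1)| ≤ 2‖g‖₁`, `‖g‖₁² ≤ 2a‖g‖₂²`). [folklore] -/
theorem abs_weilPoleForm_le (hg : IsWeilTest g) {a : ℝ} (ha0 : 0 < a) (ha1 : a ≤ 1)
    (hsupp : tsupport g ⊆ Icc (-a) a) :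
    |weilPoleForm g| ≤ 16 * a * ∫ x : ℝ, ‖g x‖ ^ 2 := by
  rw [← two_mul_re_weilMellin_zero_mul_conj_one hg]
  have h0 : ‖weilMellin g 0‖ ≤ 2 * weilNorm1 g := by
    have := norm_weilMellin_pm_half_le hg ha0 ha1 hsupp (σ := -(1 / 2)) (by norm_num [abs_neg])
    convert this using 2
    push_cast; ring
  have h1 : ‖weilMellin g 1‖ ≤ 2 * weilNorm1 g := by
    have := norm_weilMellin_pm_half_le hg ha0 ha1 hsupp (σ := 1 / 2) (by norm_num)
    convert this using 2
    push_cast; ring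
  have hL := weilNorm1_sq_le hg ha0 hsupp
  have hL0 := weilNorm1_nonneg g
  unfold weilNorm2Sq at hL
  have hre : |(weilMellin g 0 * conj (weilMellin g 1)).re| ≤ ‖weilMellin g 0‖ * ‖weilMellin g 1‖ := by
    refine (Complex.abs_re_le_norm _).trans ?_
    rw [norm_mul, Complex.norm_conj]
  rw [abs_mul, abs_two]
  have hprod : ‖weilMellin g 0‖ * ‖weilMellin g 1‖ ≤ (2 * weilNorm1 g) * (2 * weilNorm1 g) :=
    mul_le_mul h0 h1 (norm_nonneg _) (by positivity)
  nlinarith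


/-! ## The key window estimate -/

/-- The archimedean density is measurable. [folklore] -/
theorem measurable_weilArchDensity : Measurable weilArchDensity := by
  unfold weilArchDensity
  exact (Real.continuous_exp.comp (continuous_id.div_const 2)).measurable.div
    (continuous_const.mul Real.continuous_sinh).measurable

/-- **Key estimate** (Suzuki 2026, §4.2 (EQ_405) and §5.1 (EQ_501): "`R(a,v) = log(1/a) − (2A+1) +
𝓛(v)/‖v‖² + O(a)`", here before rescaling and with `2A + 1 = log 2π + γ` absorbed as
`log 4π + γ − log 2`): for a test function `g` with `tsupport g ⊆ [-a, a]`, `0 < a ≤ 1/4`,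

`|Re Q(g) − M_a(g) − (log(1/a) − log 4π − γ) ‖g‖₂²| ≤ 29 a ‖g‖₂²`,

where `M_a(g) = ∫_{(0,2a]} D_t(g) dt/(2t)` is the scale-covariant jump form of the window
(`D_t = weilIncrement`). Ingredients: the Markov decomposition
`Re Q = P + 𝓔_a − M_a‖g‖²` (`weilQuadratic_re_eq_weilPoleForm_add_weilDirichletEnergy_sub`), no primes
below `a ≤ 1/4`, `|P| ≤ 16a‖g‖²`, `D_t = 2‖g‖²` for `t ≥ 2a`, the tail
`∫_{2a}^∞ dt/(2 sinh t) = −½ log tanh a = ½ log(1/a) + O(a)` and the head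
`e^{t/2}/(2 sinh t) = 1/(2t) + O(1)` on `(0, 1]`. [cite: Suzuki2026, §4.2 (EQ_405), §5.1 (EQ_501)] -/
theorem abs_weilQuadratic_re_sub_jumpForm_le (hg : IsWeilTest g) {a : ℝ} (ha0 : 0 < a)
    (ha4 : a ≤ 1 / 4) (hsupp : tsupport g ⊆ Icc (-a) a) :
    |(weilQuadratic g).re - (∫ t in Ioc 0 (2 * a), weilIncrement g t / (2 * t)) -
        (Real.log (1 / a) - Real.log (4 * π) - Real.eulerMascheroniConstant) * ∫ x : ℝ, ‖g x‖ ^ 2|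
      ≤ 29 * a * ∫ x : ℝ, ‖g x‖ ^ 2 := by
  set N : ℝ := ∫ x : ℝ, ‖g x‖ ^ 2 with hN
  have hN0 : 0 ≤ N := integral_nonneg fun _ ↦ by positivity
  have ha1 : a ≤ 1 := by linarith
  have h2a : 0 < 2 * a := by positivity
  set D : ℝ → ℝ := weilIncrement g with hD
  set kil : ℝ → ℝ := fun t ↦ (Real.exp (t / 2) - 1) / (2 * Real.sinh t) with hkil
  set κI : ℝ := ∫ t in Ioi (0 : ℝ), kil t with hκI
  -- the Markov decomposition without primes
  have hQ : (weilQuadratic g).re = weilPoleForm g + (∫ t in Ioi (0 : ℝ), weilArchDensity t * D t) -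
      (2 * κI + (Real.log (4 * π) + Real.eulerMascheroniConstant)) * N := by
    have h := weilQuadratic_re_eq_weilPoleForm_add_weilDirichletEnergy_sub hg hsupp
    rw [weilDirichletEnergy_eq_of_le_quarter ha4, weilMarkovConstant_eq_of_le_quarter ha4] at h
    exact h
  -- integrability
  have hED : IntegrableOn (fun t ↦ weilArchDensity t * D t) (Ioi 0) :=
    integrableOn_weilArchDensity_mul_weilIncrement hg
  have hK : IntegrableOn kil (Ioi 0) := integrableOn_weilKillingDensity
  have hunion : Ioc 0 (2 * a) ∪ Ioi (2 * a) = Ioi 0 := Ioc_union_Ioi_eq_Ioi h2a.le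
  have hdisj : Disjoint (Ioc 0 (2 * a)) (Ioi (2 * a)) :=
    disjoint_left.2 fun t ht ht' ↦ (not_lt.2 ht.2) ht'
  have hIoc_sub : Ioc 0 (2 * a) ⊆ Ioi 0 := Ioc_subset_Ioi_self
  have hIoi_sub : Ioi (2 * a) ⊆ Ioi 0 := Ioi_subset_Ioi h2a.le
  -- split the energy at `2a`
  have hE_split : ∫ t in Ioi (0 : ℝ), weilArchDensity t * D t =
      (∫ t in Ioc 0 (2 * a), weilArchDensity t * D t) + ∫ t in Ioi (2 * a), weilArchDensity t * D t := by
    rw [← hunion, setIntegral_union hdisj measurableSet_Ioi (hED.mono_set hIoc_sub)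
      (hED.mono_set hIoi_sub)]
  -- the tail: `D = 2N` beyond `2a`
  have htailD : ∫ t in Ioi (2 * a), weilArchDensity t * D t =
      2 * N * ∫ t in Ioi (2 * a), weilArchDensity t := by
    rw [← integral_const_mul]
    refine setIntegral_congr_fun measurableSet_Ioi fun t ht ↦ ?_
    have ht' : 2 * a ≤ |t| := by rw [abs_of_pos (h2a.trans ht)]; exact le_of_lt ht
    rw [hD, weilIncrement_eq_two_mul_of_le_abs hg hsupp ht']
    ring
  obtain ⟨hSint, hSval⟩ := integral_Ioi_inv_two_sinh ha0
  have htailDens : ∫ t in Ioi (2 * a), weilArchDensity t =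
      (∫ t in Ioi (2 * a), 1 / (2 * Real.sinh t)) + ∫ t in Ioi (2 * a), kil t := by
    rw [← integral_add hSint (hK.mono_set hIoi_sub)]
    refine setIntegral_congr_fun measurableSet_Ioi fun t ht ↦ ?_
    have hs : Real.sinh t ≠ 0 := (Real.sinh_pos_iff.2 (h2a.trans ht)).ne'
    simp only [hkil, weilArchDensity]
    field_simp
    ring
  have hK_split : κI = (∫ t in Ioc 0 (2 * a), kil t) + ∫ t in Ioi (2 * a), kil t := by
    rw [hκI, ← hunion, setIntegral_union hdisj measurableSet_Ioi (hK.mono_set hIoc_sub)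
      (hK.mono_set hIoi_sub)]
  -- the killing head `E₂ ∈ [0, 2a]`
  have hE2_nonneg : 0 ≤ ∫ t in Ioc 0 (2 * a), kil t :=
    setIntegral_nonneg measurableSet_Ioc fun t ht ↦ weilKillingDensity_nonneg ht.1
  have hE2_le : (∫ t in Ioc 0 (2 * a), kil t) ≤ 2 * a := by
    have h := norm_setIntegral_le_of_norm_le_const (measure_Ioc_lt_top : volume (Ioc (0 : ℝ) (2 * a)) < ⊤)
      (f := kil) (C := 1) fun t ht ↦ by
        rw [Real.norm_of_nonneg (weilKillingDensity_nonneg ht.1)]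
        refine (weilKillingDensity_le ht.1).trans ?_
        exact Real.exp_le_one_iff.2 (by nlinarith [ht.1])
    rw [Real.volume_real_Ioc_of_le h2a.le, Real.norm_eq_abs, sub_zero] at h
    have := le_abs_self (∫ t in Ioc 0 (2 * a), kil t)
    linarith
  -- the head: `e^{t/2}/(2 sinh t) = 1/(2t) + O(1)`
  have hmeasD : Measurable D := (weilIncrement_continuous hg).measurable
  have hE1_int : IntegrableOn (fun t ↦ (weilArchDensity t - 1 / (2 * t)) * D t) (Ioc 0 (2 * a)) := by
    refine Measure.integrableOn_of_bounded (M := 1 * (4 * N))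
      (measure_Ioc_lt_top : volume (Ioc (0 : ℝ) (2 * a)) < ⊤).ne ?_ ?_
    · exact ((measurable_weilArchDensity.sub ((measurable_const.mul measurable_id).const_div 1)).mul
        hmeasD).aestronglyMeasurable
    · refine (ae_restrict_iff' measurableSet_Ioc).2 (Eventually.of_forall fun t ht ↦ ?_)
      rw [norm_mul, Real.norm_eq_abs, Real.norm_of_nonneg (weilIncrement_nonneg g t)]
      exact mul_le_mul (abs_weilArchDensity_sub_le ht.1 (by linarith [ht.2]))
        (weilIncrement_le_four_mul hg t) (weilIncrement_nonneg g t) zero_le_one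
  have hM_int : IntegrableOn (fun t ↦ D t / (2 * t)) (Ioc 0 (2 * a)) := by
    refine ((hED.mono_set hIoc_sub).sub hE1_int).congr (Eventually.of_forall fun t ↦ ?_)
    simp only [Pi.sub_apply]
    ring
  have hhead : ∫ t in Ioc 0 (2 * a), weilArchDensity t * D t =
      (∫ t in Ioc 0 (2 * a), D t / (2 * t)) +
        ∫ t in Ioc 0 (2 * a), (weilArchDensity t - 1 / (2 * t)) * D t := by
    rw [← integral_add hM_int hE1_int]
    refine setIntegral_congr_fun measurableSet_Ioc fun t _ ↦ ?_
    ring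
  have hE1 : |∫ t in Ioc 0 (2 * a), (weilArchDensity t - 1 / (2 * t)) * D t| ≤ 8 * a * N := by
    have h := norm_setIntegral_le_of_norm_le_const (measure_Ioc_lt_top : volume (Ioc (0 : ℝ) (2 * a)) < ⊤)
      (f := fun t ↦ (weilArchDensity t - 1 / (2 * t)) * D t) (C := 1 * (4 * N)) fun t ht ↦ by
        rw [norm_mul, Real.norm_eq_abs, Real.norm_of_nonneg (weilIncrement_nonneg g t)]
        exact mul_le_mul (abs_weilArchDensity_sub_le ht.1 (by linarith [ht.2]))
          (weilIncrement_le_four_mul hg t) (weilIncrement_nonneg g t) zero_le_one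
    rw [Real.volume_real_Ioc_of_le h2a.le, Real.norm_eq_abs, sub_zero] at h
    linarith
  -- the pole form and the tail constant
  have hP := abs_weilPoleForm_le hg ha0 ha1 hsupp
  have hlog := abs_neg_log_tanh_sub_log_inv_le ha0 ha1
  -- assemble
  have key : (weilQuadratic g).re - (∫ t in Ioc 0 (2 * a), D t / (2 * t)) -
      (Real.log (1 / a) - Real.log (4 * π) - Real.eulerMascheroniConstant) * N =
      weilPoleForm g + (∫ t in Ioc 0 (2 * a), (weilArchDensity t - 1 / (2 * t)) * D t) -
        2 * N * (∫ t in Ioc 0 (2 * a), kil t) +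
        N * (-(Real.log (Real.sinh a) - Real.log (Real.cosh a)) - Real.log (1 / a)) := by
    rw [hQ, hE_split, htailD, htailDens, hSval, hhead, hK_split]
    ring
  rw [key]
  have hNX : |N * (-(Real.log (Real.sinh a) - Real.log (Real.cosh a)) - Real.log (1 / a))| ≤ N * a := by
    rw [abs_mul, abs_of_nonneg hN0]
    exact mul_le_mul_of_nonneg_left hlog hN0
  have hNE2 : |2 * N * ∫ t in Ioc 0 (2 * a), kil t| ≤ 2 * N * (2 * a) := by
    rw [abs_of_nonneg (by positivity)]
    exact mul_le_mul_of_nonneg_left hE2_le (by positivity)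
  calc |weilPoleForm g + (∫ t in Ioc 0 (2 * a), (weilArchDensity t - 1 / (2 * t)) * D t) -
          2 * N * (∫ t in Ioc 0 (2 * a), kil t) +
          N * (-(Real.log (Real.sinh a) - Real.log (Real.cosh a)) - Real.log (1 / a))|
      ≤ |weilPoleForm g| + |∫ t in Ioc 0 (2 * a), (weilArchDensity t - 1 / (2 * t)) * D t| +
          |2 * N * ∫ t in Ioc 0 (2 * a), kil t| +
          |N * (-(Real.log (Real.sinh a) - Real.log (Real.cosh a)) - Real.log (1 / a))| := by
        have h1 := abs_add_le (weilPoleForm g +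
          (∫ t in Ioc 0 (2 * a), (weilArchDensity t - 1 / (2 * t)) * D t) -
          2 * N * (∫ t in Ioc 0 (2 * a), kil t))
          (N * (-(Real.log (Real.sinh a) - Real.log (Real.cosh a)) - Real.log (1 / a)))
        have h2 := abs_sub (weilPoleForm g +
          (∫ t in Ioc 0 (2 * a), (weilArchDensity t - 1 / (2 * t)) * D t))
          (2 * N * (∫ t in Ioc 0 (2 * a), kil t))
        have h3 := abs_add_le (weilPoleForm g)
          (∫ t in Ioc 0 (2 * a), (weilArchDensity t - 1 / (2 * t)) * D t)
        linarith
    _ ≤ 16 * a * N + 8 * a * N + 2 * N * (2 * a) + N * a := by gcongr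
    _ = 29 * a * N := by ring


/-! ## Dilation covariance of the jump form (Suzuki §4.2: rescaling to the window `(-1, 1)`) -/

/-- Increments of a dilate: `D_t(g_η) = D_{(1+η)t}(g)` for `η > -1`
(`g_η(x) = (1+η)^{1/2} g((1+η)x)`, substitute `y = (1+η)x`). [folklore] -/
theorem weilIncrement_weilDilate (g : ℝ → ℂ) {η : ℝ} (hη : -1 < η) (t : ℝ) :
    weilIncrement (weilDilate η g) t = weilIncrement g ((1 + η) * t) := by
  have hc : 0 < 1 + η := by linarith
  unfold weilIncrement weilDilate
  have e : (fun x : ℝ ↦ ‖(Real.sqrt (1 + η) : ℂ) * g ((1 + η) * (x + t)) -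
      (Real.sqrt (1 + η) : ℂ) * g ((1 + η) * x)‖ ^ 2) =
      fun x ↦ (1 + η) * (fun y : ℝ ↦ ‖g (y + (1 + η) * t) - g y‖ ^ 2) ((1 + η) * x) := by
    funext x
    rw [← mul_sub, norm_mul, mul_pow, Complex.norm_real, Real.norm_of_nonneg (Real.sqrt_nonneg _),
      Real.sq_sqrt hc.le, mul_add]
  rw [e, integral_const_mul, Measure.integral_comp_mul_left
    (fun y : ℝ ↦ ‖g (y + (1 + η) * t) - g y‖ ^ 2) (1 + η), smul_eq_mul,
    abs_of_pos (inv_pos.2 hc), ← mul_assoc, mul_inv_cancel₀ hc.ne', one_mul]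

/-- **Scale covariance of the jump form** `M_b(f) = ∫_{(0,2b]} D_t(f) dt/(2t)`:
`M_b(g_η) = M_{(1+η)b}(g)` for `η > -1`, `b ≥ 0` (substitute `s = (1+η)t`; Suzuki §4.2,
(EQ_401)–(EQ_402): the Rayleigh quotient on `[-a,a]` equals the rescaled one on `[-1,1]`).
[cite: Suzuki2026, §4.2 (EQ_401)–(EQ_402)] -/
theorem jumpForm_weilDilate (g : ℝ → ℂ) {η : ℝ} (hη : -1 < η) {b : ℝ} (hb : 0 ≤ b) :
    ∫ t in Ioc 0 (2 * b), weilIncrement (weilDilate η g) t / (2 * t) =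
      ∫ t in Ioc 0 (2 * ((1 + η) * b)), weilIncrement g t / (2 * t) := by
  have hc : 0 < 1 + η := by linarith
  simp_rw [weilIncrement_weilDilate g hη]
  rw [← intervalIntegral.integral_of_le (by positivity : (0 : ℝ) ≤ 2 * b),
    ← intervalIntegral.integral_of_le (by positivity : (0 : ℝ) ≤ 2 * ((1 + η) * b))]
  have e : ∀ t : ℝ, weilIncrement g ((1 + η) * t) / (2 * t) =
      (1 + η) * (fun s ↦ weilIncrement g s / (2 * s)) ((1 + η) * t) := by
    intro t
    simp only
    rcases eq_or_ne t 0 with rfl | ht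
    · simp
    · field_simp
  simp_rw [e]
  rw [intervalIntegral.integral_const_mul, ← smul_eq_mul]
  have h := intervalIntegral.smul_integral_comp_mul_left (a := 0) (b := 2 * b)
    (f := fun s ↦ weilIncrement g s / (2 * s)) (1 + η)
  simp only [mul_zero] at h
  rw [show (1 + η) * (2 * b) = 2 * ((1 + η) * b) by ring] at h
  exact h

/-- The window `[-a, a]` rescaled to `[-1, 1]`: `tsupport g_{a-1} ⊆ [-1, 1]`. [folklore] -/
theorem tsupport_weilDilate_window {a : ℝ} (ha : 0 < a) (hsupp : tsupport g ⊆ Icc (-a) a) :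
    tsupport (weilDilate (a - 1) g) ⊆ Icc (-1) 1 := by
  have h := tsupport_weilDilate_subset g (by linarith : -1 < a - 1) hsupp
  have e : a / (1 + (a - 1)) = 1 := by
    rw [show (1 : ℝ) + (a - 1) = a by ring]
    exact div_self ha.ne'
  rwa [e] at h

/-- … and its jump form: `M_1(g_{a-1}) = M_a(g)`. [folklore] -/
theorem jumpForm_weilDilate_window (g : ℝ → ℂ) {a : ℝ} (ha : 0 < a) :
    ∫ t in Ioc 0 2, weilIncrement (weilDilate (a - 1) g) t / (2 * t) =
      ∫ t in Ioc 0 (2 * a), weilIncrement g t / (2 * t) := by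
  have h := jumpForm_weilDilate g (by linarith : -1 < a - 1) zero_le_one
  rwa [mul_one, show (1 : ℝ) + (a - 1) = a by ring, mul_one] at h

/-- The window `[-1, 1]` rescaled to `[-a, a]`: `tsupport w_{1/a-1} ⊆ [-a, a]`. [folklore] -/
theorem tsupport_weilDilate_window' {w : ℝ → ℂ} {a : ℝ} (ha : 0 < a)
    (hws : tsupport w ⊆ Icc (-1) 1) : tsupport (weilDilate (1 / a - 1) w) ⊆ Icc (-a) a := by
  have hη : -1 < 1 / a - 1 := by have := one_div_pos.2 ha; linarith
  have h := tsupport_weilDilate_subset w hη hws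
  have e : 1 / (1 + (1 / a - 1)) = a := by
    rw [show (1 : ℝ) + (1 / a - 1) = 1 / a by ring, one_div_one_div]
  rwa [e] at h

/-- … and its jump form: `M_a(w_{1/a-1}) = M_1(w)`. [folklore] -/
theorem jumpForm_weilDilate_window' (w : ℝ → ℂ) {a : ℝ} (ha : 0 < a) :
    ∫ t in Ioc 0 (2 * a), weilIncrement (weilDilate (1 / a - 1) w) t / (2 * t) =
      ∫ t in Ioc 0 2, weilIncrement w t / (2 * t) := by
  have hη : -1 < 1 / a - 1 := by have := one_div_pos.2 ha; linarith
  have h := jumpForm_weilDilate w hη ha.le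
  have e : (1 + (1 / a - 1)) * a = 1 := by
    rw [show (1 : ℝ) + (1 / a - 1) = 1 / a by ring, one_div_mul_cancel ha.ne']
  rwa [e, mul_one] at h


/-! ## The jump form converges for test functions -/

/-- For a test function `g` and every `b`, `t ↦ D_t(g)/(2t)` is integrable on `(0, b]`
(near `0` it is the finite archimedean energy up to a bounded error; beyond `1` it is bounded). [folklore] -/
theorem integrableOn_jumpForm (hg : IsWeilTest g) (b : ℝ) :
    IntegrableOn (fun t ↦ weilIncrement g t / (2 * t)) (Ioc 0 b) := by
  set N : ℝ := ∫ x : ℝ, ‖g x‖ ^ 2 with hN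
  have hmeasD : Measurable (weilIncrement g) := (weilIncrement_continuous hg).measurable
  have hmeas : Measurable fun t ↦ weilIncrement g t / (2 * t) :=
    hmeasD.div (measurable_const.mul measurable_id)
  have h1 : IntegrableOn (fun t ↦ weilIncrement g t / (2 * t)) (Ioc 0 1) := by
    have hED := (integrableOn_weilArchDensity_mul_weilIncrement hg).mono_set
      (Ioc_subset_Ioi_self : Ioc (0 : ℝ) 1 ⊆ Ioi 0)
    have hE1 : IntegrableOn (fun t ↦ (weilArchDensity t - 1 / (2 * t)) * weilIncrement g t)
        (Ioc 0 1) := by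
      refine Measure.integrableOn_of_bounded (M := 1 * (4 * N))
        (measure_Ioc_lt_top : volume (Ioc (0 : ℝ) 1) < ⊤).ne ?_ ?_
      · exact ((measurable_weilArchDensity.sub ((measurable_const.mul measurable_id).const_div 1)).mul
          hmeasD).aestronglyMeasurable
      · refine (ae_restrict_iff' measurableSet_Ioc).2 (Eventually.of_forall fun t ht ↦ ?_)
        rw [norm_mul, Real.norm_eq_abs, Real.norm_of_nonneg (weilIncrement_nonneg g t)]
        exact mul_le_mul (abs_weilArchDensity_sub_le ht.1 ht.2)
          (weilIncrement_le_four_mul hg t) (weilIncrement_nonneg g t) zero_le_one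
    exact (hED.sub hE1).congr (Eventually.of_forall fun t ↦ by simp only [Pi.sub_apply]; ring)
  have h2 : IntegrableOn (fun t ↦ weilIncrement g t / (2 * t)) (Ioc 1 b) := by
    refine Measure.integrableOn_of_bounded (M := 4 * N)
      (measure_Ioc_lt_top : volume (Ioc (1 : ℝ) b) < ⊤).ne hmeas.aestronglyMeasurable ?_
    refine (ae_restrict_iff' measurableSet_Ioc).2 (Eventually.of_forall fun t ht ↦ ?_)
    rw [Real.norm_of_nonneg (div_nonneg (weilIncrement_nonneg g t) (by linarith [ht.1]))]
    calc weilIncrement g t / (2 * t) ≤ weilIncrement g t / 1 :=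
          div_le_div_of_nonneg_left (weilIncrement_nonneg g t) one_pos (by linarith [ht.1])
      _ ≤ 4 * N := by rw [div_one]; exact weilIncrement_le_four_mul hg t
  exact (h1.union h2).mono_set Ioc_subset_Ioc_union_Ioc

/-! ## The scale-free lower bound (Suzuki §5.1: `μ₁ = inf 𝓛(v)/‖v‖² > 0`, made quantitative) -/

section LowerBound

variable {w v : ℝ → ℂ}

/-- A test function supported in `[-1, 1]` vanishes off `(-1, 1)`. [folklore] -/
theorem eq_zero_of_not_mem_Ioo_one (hw : IsWeilTest w) (hws : tsupport w ⊆ Icc (-1) 1) {u : ℝ}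
    (hu : u ∉ Ioo (-1 : ℝ) 1) : w u = 0 :=
  Function.notMem_support.1 fun h ↦
    hu (support_subset_Ioo_of_tsupport_subset_Icc hw.1.continuous hws h)

/-- Pointwise splitting of the increment integrand of a function supported in `[-1,1]` at a lag
`t`: left strip (`u ≤ t − 1`, where `w(u − t) = 0`), right strip (`u ≥ 1`, where `w(u) = 0`)
and bulk (`t − 1 < u < 1`). [folklore] -/
theorem norm_sub_sq_eq_indicator_add (hw : IsWeilTest w) (hws : tsupport w ⊆ Icc (-1) 1)
    (t u : ℝ) :
    ‖w u - w (u - t)‖ ^ 2 =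
      (Iic (t - 1)).indicator (fun u ↦ ‖w u‖ ^ 2) u +
        (Ici 1).indicator (fun u ↦ ‖w (u - t)‖ ^ 2) u +
        (Ioo (t - 1) 1).indicator (fun u ↦ ‖w u - w (u - t)‖ ^ 2) u := by
  simp only [Set.indicator_apply, mem_Iic, mem_Ici, mem_Ioo]
  by_cases h1 : u ≤ t - 1
  · have hz : w (u - t) = 0 := eq_zero_of_not_mem_Ioo_one hw hws fun h ↦ by
      have := h.1; linarith
    have hnot : ¬(t - 1 < u ∧ u < 1) := fun h ↦ by linarith [h.1]
    by_cases h2 : 1 ≤ u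
    · have hz' : w u = 0 := eq_zero_of_not_mem_Ioo_one hw hws fun h ↦ by
        have := h.2; linarith
      simp only [if_pos h1, if_pos h2, if_neg hnot, hz, hz', sub_zero, norm_zero, add_zero]
      ring
    · simp only [if_pos h1, if_neg h2, if_neg hnot, hz, sub_zero, add_zero]
  · have h1' : t - 1 < u := not_le.1 h1
    by_cases h2 : 1 ≤ u
    · have hz' : w u = 0 := eq_zero_of_not_mem_Ioo_one hw hws fun h ↦ by
        have := h.2; linarith
      have hnot : ¬(t - 1 < u ∧ u < 1) := fun h ↦ by linarith [h.2]
      simp only [if_neg h1, if_pos h2, if_neg hnot, hz', zero_sub, norm_neg, zero_add, add_zero]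
    · have h2' : u < 1 := not_le.1 h2
      simp only [if_neg h1, if_neg h2, if_pos (And.intro h1' h2'), zero_add]

/-- **Strip–bulk decomposition of the increment**: for `w` supported in `[-1,1]` and every lag `t`,
`D_t(w) = A_t(w) + A_t(w(−·)) + C_t(w)`, with the strip mass `A_t(v) = ∫_{u ≤ t−1} |v(u)|²`
(the right strip being the left strip of the reflected function) and the bulk
`C_t(w) = ∫_{(t−1,1)} |w(u) − w(u−t)|²`. [folklore] -/
theorem weilIncrement_eq_strip_add_bulk (hw : IsWeilTest w) (hws : tsupport w ⊆ Icc (-1) 1)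
    (t : ℝ) :
    weilIncrement w t = (∫ u in Iic (t - 1), ‖w u‖ ^ 2) + (∫ u in Iic (t - 1), ‖w (-u)‖ ^ 2) +
      ∫ u in Ioo (t - 1) 1, ‖w u - w (u - t)‖ ^ 2 := by
  have h2 : Integrable fun u : ℝ ↦ ‖w u‖ ^ 2 := hw.integrable_norm_sq
  have h2' : Integrable fun u : ℝ ↦ ‖w (u - t)‖ ^ 2 := h2.comp_sub_right t
  have hD : Integrable fun u : ℝ ↦ ‖w u - w (u - t)‖ ^ 2 := by
    have h := integrable_weilIncrement_integrand hw.memLp_two (-t)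
    refine h.congr (Eventually.of_forall fun u ↦ ?_)
    simp only [← sub_eq_add_neg]
    rw [norm_sub_rev]
  have hB : ∫ u, (Ici (1 : ℝ)).indicator (fun u ↦ ‖w (u - t)‖ ^ 2) u =
      ∫ u in Iic (t - 1), ‖w (-u)‖ ^ 2 := by
    rw [← integral_indicator measurableSet_Iic,
      ← integral_sub_left_eq_self (fun u ↦ (Ici (1 : ℝ)).indicator (fun u ↦ ‖w (u - t)‖ ^ 2) u)
        volume t]
    congr 1 with v
    simp only [Set.indicator_apply, mem_Ici, mem_Iic]
    rw [show t - v - t = -v by ring]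
    by_cases hv : v ≤ t - 1
    · rw [if_pos (by linarith), if_pos hv]
    · rw [if_neg (fun h ↦ hv (by linarith)), if_neg hv]
  have h12 : Integrable fun a ↦ (Iic (t - 1)).indicator (fun u ↦ ‖w u‖ ^ 2) a +
      (Ici 1).indicator (fun u ↦ ‖w (u - t)‖ ^ 2) a :=
    (h2.indicator measurableSet_Iic).add (h2'.indicator measurableSet_Ici)
  rw [weilIncrement_eq_integral_sub,
    integral_congr_ae (Eventually.of_forall (norm_sub_sq_eq_indicator_add hw hws t)),
    integral_add h12 (hD.indicator measurableSet_Ioo),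
    integral_add (h2.indicator measurableSet_Iic) (h2'.indicator measurableSet_Ici),
    integral_indicator measurableSet_Iic, hB, integral_indicator measurableSet_Ioo]

/-- The strip mass `t ↦ A_t(v) = ∫_{u ≤ t−1} |v(u)|²` is monotone, hence measurable. [folklore] -/
theorem monotone_strip (hv : IsWeilTest v) :
    Monotone fun t : ℝ ↦ ∫ u in Iic (t - 1), ‖v u‖ ^ 2 := by
  intro t₁ t₂ h
  exact setIntegral_mono_set hv.integrable_norm_sq.integrableOn
    (Eventually.of_forall fun _ ↦ by positivity)
    (Eventually.of_forall fun u (hu : u ≤ t₁ - 1) ↦ show u ≤ t₂ - 1 by linarith)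

/-- **Strip masses integrate to a weighted norm** (Fubini): for `v` supported in `[-1, 1]` and a
measurable weight `ψ ≥ 0` on `(0, 2]` with `ψ · A(v)` integrable there,
`∫_{(0,2]} ψ(t) A_t(v) dt = ∫ |v(u)|² (∫_{[u+1, 2]} ψ) du`, the right-hand integrand being
integrable. [folklore] -/
theorem integral_weight_mul_strip (hv : IsWeilTest v) (hvs : tsupport v ⊆ Icc (-1) 1)
    {ψ : ℝ → ℝ} (hψm : Measurable ψ) (hψ0 : ∀ t ∈ Ioc (0 : ℝ) 2, 0 ≤ ψ t)
    (hint : IntegrableOn (fun t ↦ ψ t * ∫ u in Iic (t - 1), ‖v u‖ ^ 2) (Ioc 0 2)) :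
    (∫ t in Ioc 0 2, ψ t * ∫ u in Iic (t - 1), ‖v u‖ ^ 2) =
        ∫ u, ‖v u‖ ^ 2 * ∫ t in Icc (u + 1) 2, ψ t ∧
      Integrable fun u ↦ ‖v u‖ ^ 2 * ∫ t in Icc (u + 1) 2, ψ t := by
  set μ : Measure ℝ := volume.restrict (Ioc (0 : ℝ) 2) with hμ
  set F : ℝ × ℝ → ℝ := fun p ↦
    ψ p.1 * {q : ℝ × ℝ | q.2 ≤ q.1 - 1}.indicator (fun q ↦ ‖v q.2‖ ^ 2) p with hF
  have hS : MeasurableSet {q : ℝ × ℝ | q.2 ≤ q.1 - 1} :=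
    measurableSet_le measurable_snd (measurable_fst.sub measurable_const)
  have hvm : Measurable fun q : ℝ × ℝ ↦ ‖v q.2‖ ^ 2 :=
    (hv.1.continuous.norm.measurable.pow_const 2).comp measurable_snd
  have hFm : Measurable F := (hψm.comp measurable_fst).mul (hvm.indicator hS)
  have h2 : Integrable fun u : ℝ ↦ ‖v u‖ ^ 2 := hv.integrable_norm_sq
  -- `u`-sections
  have hsec_t : ∀ t u, F (t, u) = ψ t * (Iic (t - 1)).indicator (fun u ↦ ‖v u‖ ^ 2) u := by
    intro t u
    simp only [hF, Set.indicator_apply, mem_setOf_eq, mem_Iic]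
  have hint_t : ∀ t, ∫ u, F (t, u) = ψ t * ∫ u in Iic (t - 1), ‖v u‖ ^ 2 := by
    intro t
    simp_rw [hsec_t t]
    rw [integral_const_mul, integral_indicator measurableSet_Iic]
  -- `t`-sections
  have hsec_u : ∀ u t, F (t, u) = ‖v u‖ ^ 2 * (Ici (u + 1)).indicator ψ t := by
    intro u t
    simp only [hF, Set.indicator_apply, mem_setOf_eq, mem_Ici]
    by_cases h : u ≤ t - 1
    · rw [if_pos h, if_pos (by linarith)]; ring
    · rw [if_neg h, if_neg (fun h' ↦ h (by linarith))]; ring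
  have hint_u : ∀ u, ∫ t, F (t, u) ∂μ = ‖v u‖ ^ 2 * ∫ t in Icc (u + 1) 2, ψ t := by
    intro u
    simp_rw [hsec_u u]
    rw [integral_const_mul]
    by_cases hu : u ∈ Ioo (-1 : ℝ) 1
    · have hset : Ioc (0 : ℝ) 2 ∩ Ici (u + 1) = Icc (u + 1) 2 := by
        ext t
        simp only [mem_inter_iff, mem_Ioc, mem_Ici, mem_Icc]
        constructor
        · rintro ⟨⟨-, ht2⟩, ht3⟩
          exact ⟨ht3, ht2⟩
        · rintro ⟨ht1, ht2⟩
          exact ⟨⟨by linarith [hu.1], ht2⟩, ht1⟩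
      rw [hμ, setIntegral_indicator measurableSet_Ici, hset]
    · rw [eq_zero_of_not_mem_Ioo_one hv hvs hu]
      simp
  -- integrability on the product
  have hFint : Integrable F (μ.prod volume) := by
    refine (integrable_prod_iff hFm.aestronglyMeasurable).2 ⟨Eventually.of_forall fun t ↦ ?_, ?_⟩
    · have : (fun u ↦ F (t, u)) = fun u ↦ ψ t * (Iic (t - 1)).indicator (fun u ↦ ‖v u‖ ^ 2) u :=
        funext (hsec_t t)
      rw [this]
      exact (h2.indicator measurableSet_Iic).const_mul _
    · refine hint.congr ((ae_restrict_iff' measurableSet_Ioc).2 (Eventually.of_forall fun t ht ↦ ?_))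
      show ψ t * (∫ u in Iic (t - 1), ‖v u‖ ^ 2) = ∫ u, ‖F (t, u)‖
      rw [← hint_t t]
      refine integral_congr_ae (Eventually.of_forall fun u ↦ ?_)
      show F (t, u) = ‖F (t, u)‖
      rw [Real.norm_of_nonneg]
      rw [hsec_t]
      exact mul_nonneg (hψ0 t ht) (Set.indicator_nonneg (fun _ _ ↦ by positivity) _)
  have hprod := integral_prod F hFint
  have hprod' := integral_prod_symm F hFint
  refine ⟨?_, ?_⟩
  · calc (∫ t in Ioc 0 2, ψ t * ∫ u in Iic (t - 1), ‖v u‖ ^ 2)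
        = ∫ t, ∫ u, F (t, u) ∂volume ∂μ := by simp_rw [hint_t]; rw [hμ]
      _ = ∫ u, ∫ t, F (t, u) ∂μ := by rw [← hprod, hprod']
      _ = ∫ u, ‖v u‖ ^ 2 * ∫ t in Icc (u + 1) 2, ψ t := by simp_rw [hint_u]
  · have h := hFint.integral_prod_right
    have e : (fun u ↦ ∫ t, F (t, u) ∂μ) = fun u ↦ ‖v u‖ ^ 2 * ∫ t in Icc (u + 1) 2, ψ t :=
      funext hint_u
    rw [e] at h
    exact h


/-- The killing weight of the strips: `∫_{[u+1,2]} dt/(2t) = ½ (log 2 − log(u+1))` for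
`-1 < u ≤ 1`. [folklore] -/
theorem integral_Icc_one_div_two_mul {u : ℝ} (hu : -1 < u) (hu1 : u ≤ 1) :
    ∫ t in Icc (u + 1) 2, 1 / (2 * t) = 1 / 2 * (Real.log 2 - Real.log (u + 1)) := by
  have hle : u + 1 ≤ 2 := by linarith
  rw [integral_Icc_eq_integral_Ioc, ← intervalIntegral.integral_of_le hle]
  have e : (fun t : ℝ ↦ 1 / (2 * t)) = fun t ↦ 1 / 2 * t⁻¹ := by
    funext t
    rw [one_div, mul_inv, one_div]
  rw [e, intervalIntegral.integral_const_mul, integral_inv_of_pos (by linarith) two_pos,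
    Real.log_div two_ne_zero (by linarith)]

/-- `log(1 + u) + log(1 − u) ≤ −u²` on `(-1, 1)`, i.e. the strip weight dominates
`log 2 + u²/2`. [folklore] -/
theorem strip_weight_ge {u : ℝ} (hu : u ∈ Ioo (-1 : ℝ) 1) :
    Real.log 2 + u ^ 2 / 2 ≤
      1 / 2 * (Real.log 2 - Real.log (u + 1)) + 1 / 2 * (Real.log 2 - Real.log (-u + 1)) := by
  have h1 : 0 < u + 1 := by linarith [hu.1]
  have h2 : 0 < -u + 1 := by linarith [hu.2]
  have hlog : Real.log (u + 1) + Real.log (-u + 1) ≤ -u ^ 2 := by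
    rw [← Real.log_mul h1.ne' h2.ne']
    have := Real.log_le_sub_one_of_pos (mul_pos h1 h2)
    nlinarith
  linarith

/-- `∫_{(0,2]} D_t(w) dt = 4‖w‖₂² − |∫ w|²` for `w` supported in `[-1, 1]`
(`D_t = 2‖w‖² − (k(t) + k(−t))`, `∫₀² (k(t) + k(−t)) dt = ∫ k = (∫ w)(∫ w̃) = |∫ w|²`). [folklore] -/
theorem integral_Ioc_weilIncrement (hw : IsWeilTest w) (hws : tsupport w ⊆ Icc (-1) 1) :
    ∫ t in Ioc 0 2, weilIncrement w t = 4 * (∫ x, ‖w x‖ ^ 2) - ‖∫ x, w x‖ ^ 2 := by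
  set k : ℝ → ℂ := weilConv w (weilReflect w) with hk
  have hkt : IsWeilTest k := hw.weilConv hw.weilReflect
  have hkc : Continuous k := hkt.1.continuous
  have hks : tsupport k ⊆ Icc (-(2 * 1)) (2 * 1) := tsupport_weilConv_weilReflect_subset hw.2 hws
  -- `∫ k = |∫ w|²`
  have hIk : ∫ t, k t = ((‖∫ x, w x‖ ^ 2 : ℝ) : ℂ) := by
    have hwi : Integrable w := hw.1.continuous.integrable_of_hasCompactSupport hw.2
    have hwri : Integrable (weilReflect w) :=
      hw.weilReflect.1.continuous.integrable_of_hasCompactSupport hw.weilReflect.2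
    have hr : ∫ x, weilReflect w x = conj (∫ x, w x) := by
      simp only [weilReflect]
      rw [integral_conj, integral_neg_eq_self w volume]
    rw [hk, weilConv, integral_convolution (L := ContinuousLinearMap.mul ℂ ℂ) hwi hwri,
      ContinuousLinearMap.mul_apply', hr, Complex.mul_conj, Complex.normSq_eq_norm_sq]
  -- `∫₀² (k(t) + k(−t)) dt = ∫ k`
  have hi1 : IntervalIntegrable k volume 0 2 := hkc.intervalIntegrable _ _
  have hi2 : IntervalIntegrable k volume (-2) 0 := hkc.intervalIntegrable _ _
  have hi3 : IntervalIntegrable (fun t ↦ k (-t)) volume 0 2 :=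
    (hkc.comp continuous_neg).intervalIntegrable _ _
  have hsum : ∫ t in (0 : ℝ)..2, (k t + k (-t)) = ∫ t, k t := by
    rw [intervalIntegral.integral_add hi1 hi3, intervalIntegral.integral_comp_neg, neg_zero,
      add_comm, intervalIntegral.integral_add_adjacent_intervals hi2 hi1]
    apply intervalIntegral.integral_eq_integral_of_support_subset
    intro x hx
    have h := support_subset_Ioo_of_tsupport_subset_Icc hkc hks hx
    exact ⟨by linarith [h.1], by linarith [h.2]⟩
  -- assemble in `ℂ`
  have hD : ∀ t, ((weilIncrement w t : ℝ) : ℂ) =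
      2 * ((∫ x, ‖w x‖ ^ 2 : ℝ) : ℂ) - (k t + k (-t)) := by
    intro t
    rw [weilConv_weilReflect_add_neg hw t]
    push_cast
    ring
  have hi4 : IntervalIntegrable (fun _ : ℝ ↦ 2 * ((∫ x, ‖w x‖ ^ 2 : ℝ) : ℂ)) volume 0 2 :=
    intervalIntegrable_const
  apply Complex.ofReal_injective
  rw [← intervalIntegral.integral_of_le zero_le_two, ← intervalIntegral.integral_ofReal]
  simp_rw [hD]
  rw [intervalIntegral.integral_sub hi4 (hi1.add hi3), intervalIntegral.integral_const, hsum, hIk,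
    Complex.real_smul]
  push_cast
  ring

/-- **Weighted mean inequality**: for `w` supported in `[-1,1]`,
`|∫ w|² ≤ (5/3)(‖w‖₂² + ∫ x²|w(x)|² dx)` (complete the square against the weight `1 − x²/2`,
whose integral over `[-1,1]` is `5/3`, using `(1 + x²)(1 − x²/2) ≥ 1` on `[-1,1]`). [folklore] -/
theorem norm_sq_integral_le_five_thirds (hw : IsWeilTest w) (hws : tsupport w ⊆ Icc (-1) 1) :
    ‖∫ x, w x‖ ^ 2 ≤ 5 / 3 * ((∫ x, ‖w x‖ ^ 2) + ∫ x, x ^ 2 * ‖w x‖ ^ 2) := by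
  set S : ℂ := ∫ x, w x with hS
  set c : ℂ := ((3 / 5 : ℝ) : ℂ) * S with hc
  have hwc : Continuous w := hw.1.continuous
  -- pointwise inequality on `[-1, 1]`
  have hpt : ∀ x ∈ Icc (-1 : ℝ) 1,
      0 ≤ (1 + x ^ 2) * ‖w x‖ ^ 2 - 2 * (conj c * w x).re + ‖c‖ ^ 2 * (1 - x ^ 2 / 2) := by
    intro x hx
    have hs0 : 0 ≤ x ^ 2 := sq_nonneg x
    have hs1 : x ^ 2 ≤ 1 := by nlinarith [hx.1, hx.2]
    have hre : (conj c * w x).re ≤ ‖c‖ * ‖w x‖ := by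
      refine (Complex.re_le_norm _).trans ?_
      rw [norm_mul, Complex.norm_conj]
    have h1s : 0 < 1 + x ^ 2 := by positivity
    have key : (1 + x ^ 2) *
        ((1 + x ^ 2) * ‖w x‖ ^ 2 - 2 * (conj c * w x).re + ‖c‖ ^ 2 * (1 - x ^ 2 / 2)) =
        ((1 + x ^ 2) * ‖w x‖ - ‖c‖) ^ 2 + 2 * (1 + x ^ 2) * (‖c‖ * ‖w x‖ - (conj c * w x).re) +
          x ^ 2 * (1 - x ^ 2) / 2 * ‖c‖ ^ 2 := by
      ring
    have hnn : 0 ≤ (1 + x ^ 2) *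
        ((1 + x ^ 2) * ‖w x‖ ^ 2 - 2 * (conj c * w x).re + ‖c‖ ^ 2 * (1 - x ^ 2 / 2)) := by
      rw [key]
      have h3 : 0 ≤ x ^ 2 * (1 - x ^ 2) / 2 * ‖c‖ ^ 2 := by
        have := mul_nonneg hs0 (sub_nonneg.2 hs1)
        positivity
      have h2 : 0 ≤ 2 * (1 + x ^ 2) * (‖c‖ * ‖w x‖ - (conj c * w x).re) :=
        mul_nonneg (by positivity) (by linarith)
      nlinarith [sq_nonneg ((1 + x ^ 2) * ‖w x‖ - ‖c‖)]
    exact (mul_nonneg_iff_of_pos_left h1s).1 hnn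
  have hI := setIntegral_nonneg (μ := volume) (measurableSet_Icc : MeasurableSet (Icc (-1 : ℝ) 1)) hpt
  -- split and evaluate
  have hi1 : IntegrableOn (fun x : ℝ ↦ (1 + x ^ 2) * ‖w x‖ ^ 2) (Icc (-1) 1) :=
    (by fun_prop : Continuous fun x : ℝ ↦ (1 + x ^ 2) * ‖w x‖ ^ 2).integrableOn_Icc
  have hi2 : IntegrableOn (fun x : ℝ ↦ 2 * (conj c * w x).re) (Icc (-1) 1) :=
    (by fun_prop : Continuous fun x : ℝ ↦ 2 * (conj c * w x).re).integrableOn_Icc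
  have hi3 : IntegrableOn (fun x : ℝ ↦ ‖c‖ ^ 2 * (1 - x ^ 2 / 2)) (Icc (-1) 1) :=
    (by fun_prop : Continuous fun x : ℝ ↦ ‖c‖ ^ 2 * (1 - x ^ 2 / 2)).integrableOn_Icc
  have hi12 : IntegrableOn (fun x : ℝ ↦ (1 + x ^ 2) * ‖w x‖ ^ 2 - 2 * (conj c * w x).re)
      (Icc (-1) 1) := hi1.sub hi2
  rw [integral_add hi12 hi3, integral_sub hi1 hi2] at hI
  have hzero : ∀ x, x ∉ Icc (-1 : ℝ) 1 → w x = 0 := fun x hx ↦ eq_zero_of_tsupport_subset hws hx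
  have hcs2 : HasCompactSupport fun x : ℝ ↦ ‖w x‖ ^ 2 :=
    hw.2.norm.comp_left (g := fun r : ℝ ↦ r ^ 2) (zero_pow two_ne_zero)
  have hx2c : Continuous fun x : ℝ ↦ x ^ 2 * ‖w x‖ ^ 2 := by fun_prop
  have hx2 : Integrable fun x : ℝ ↦ x ^ 2 * ‖w x‖ ^ 2 :=
    hx2c.integrable_of_hasCompactSupport hcs2.mul_left
  have e1 : ∫ x in Icc (-1 : ℝ) 1, (1 + x ^ 2) * ‖w x‖ ^ 2 =
      (∫ x, ‖w x‖ ^ 2) + ∫ x, x ^ 2 * ‖w x‖ ^ 2 := by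
    rw [setIntegral_eq_integral_of_forall_compl_eq_zero fun x hx ↦ by rw [hzero x hx]; simp,
      ← integral_add hw.integrable_norm_sq hx2]
    congr 1 with x
    ring
  have e2 : ∫ x in Icc (-1 : ℝ) 1, 2 * (conj c * w x).re = 2 * (3 / 5 * ‖S‖ ^ 2) := by
    rw [setIntegral_eq_integral_of_forall_compl_eq_zero fun x hx ↦ by rw [hzero x hx]; simp,
      integral_const_mul]
    congr 1
    have h := Complex.reCLM.integral_comp_comm
      ((hwc.integrable_of_hasCompactSupport (μ := volume) hw.2).const_mul (conj c))
    simp only [Complex.reCLM_apply] at h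
    rw [h, integral_const_mul]
    have : conj c * S = (((3 / 5 : ℝ) * ‖S‖ ^ 2 : ℝ) : ℂ) := by
      rw [hc, map_mul, Complex.conj_ofReal, mul_assoc, ← Complex.normSq_eq_conj_mul_self,
        Complex.normSq_eq_norm_sq]
      push_cast
      ring
    rw [← hS, this, Complex.ofReal_re]
  have e3 : ∫ x in Icc (-1 : ℝ) 1, ‖c‖ ^ 2 * (1 - x ^ 2 / 2) = ‖c‖ ^ 2 * (5 / 3) := by
    rw [integral_const_mul]
    congr 1
    rw [integral_Icc_eq_integral_Ioc, ← intervalIntegral.integral_of_le (by norm_num : (-1 : ℝ) ≤ 1),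
      intervalIntegral.integral_sub intervalIntegrable_const
        ((by fun_prop : Continuous fun x : ℝ ↦ x ^ 2 / 2).intervalIntegrable _ _),
      intervalIntegral.integral_const, intervalIntegral.integral_div, integral_pow]
    norm_num
  have hcn : ‖c‖ ^ 2 = 9 / 25 * ‖S‖ ^ 2 := by
    rw [hc, norm_mul, Complex.norm_real, Real.norm_of_nonneg (by norm_num : (0 : ℝ) ≤ 3 / 5)]
    ring
  rw [e1, e2, e3, hcn] at hI
  nlinarith [hI]

/-- The reflection `w(−·)` of a test function supported in `[-1,1]` is one as well. [folklore] -/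
theorem isWeilTest_reflect_window (hw : IsWeilTest w) (hws : tsupport w ⊆ Icc (-1) 1) :
    IsWeilTest (fun u ↦ w (-u)) ∧ tsupport (fun u ↦ w (-u)) ⊆ Icc (-1) 1 := by
  refine ⟨⟨hw.1.comp contDiff_neg, hw.2.comp_homeomorph (Homeomorph.neg ℝ)⟩, fun x hx ↦ ?_⟩
  have hx' : -x ∈ tsupport w := by
    have e : (fun t ↦ w (-t)) = w ∘ (Homeomorph.neg ℝ) := rfl
    rw [e, tsupport_comp_eq_preimage] at hx
    simpa using hx
  have := hws hx'
  simp only [mem_Icc] at this ⊢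
  constructor <;> linarith [this.1, this.2]

/-- **The scale-free form is bounded below by `log 2 + 1/12`**: for every test function `w`
supported in `[-1, 1]`, `M_1(w) = ∫_{(0,2]} D_t(w) dt/(2t) ≥ (log 2 + 1/12) ‖w‖₂²`.
Quantitative form of Suzuki's `μ₁ = inf 𝓛̄ > 0` (§5.1; `M_1 = 𝓛 + (log 2)‖w‖²`): by the
strip–bulk decomposition the strips carry the killing weight `log 2 − ½ log(1−u²) ≥ log 2 + u²/2`,
the bulk carries `≥ ¼ ∫₀² C_t = ½‖w‖² − ¼|∫w|²`, and `|∫ w|² ≤ (5/3)(‖w‖² + ∫ u²|w|²)`.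
[cite: Suzuki2026, §5.1 (EQ_501) and the claim inf 𝓛̄ > 0] -/
theorem jumpForm_window_one_ge (hw : IsWeilTest w) (hws : tsupport w ⊆ Icc (-1) 1) :
    (Real.log 2 + 1 / 12) * ∫ x, ‖w x‖ ^ 2 ≤ ∫ t in Ioc 0 2, weilIncrement w t / (2 * t) := by
  set N : ℝ := ∫ x, ‖w x‖ ^ 2 with hN
  set U : ℝ := ∫ x, x ^ 2 * ‖w x‖ ^ 2 with hU
  obtain ⟨hwn, hwns⟩ := isWeilTest_reflect_window hw hws
  set wn : ℝ → ℂ := fun u ↦ w (-u) with hwn_def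
  set D : ℝ → ℝ := weilIncrement w with hD
  set A : ℝ → ℝ := fun t ↦ ∫ u in Iic (t - 1), ‖w u‖ ^ 2 with hA
  set An : ℝ → ℝ := fun t ↦ ∫ u in Iic (t - 1), ‖wn u‖ ^ 2 with hAn
  set C : ℝ → ℝ := fun t ↦ ∫ u in Ioo (t - 1) 1, ‖w u - w (u - t)‖ ^ 2 with hC
  have hwc : Continuous w := hw.1.continuous
  have hdec : ∀ t, D t = A t + An t + C t := fun t ↦ weilIncrement_eq_strip_add_bulk hw hws t
  have hA0 : ∀ t, 0 ≤ A t := fun t ↦ setIntegral_nonneg measurableSet_Iic fun _ _ ↦ by positivity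
  have hAn0 : ∀ t, 0 ≤ An t := fun t ↦ setIntegral_nonneg measurableSet_Iic fun _ _ ↦ by positivity
  have hC0 : ∀ t, 0 ≤ C t := fun t ↦ setIntegral_nonneg measurableSet_Ioo fun _ _ ↦ by positivity
  have hU0 : 0 ≤ U := integral_nonneg fun _ ↦ by positivity
  -- measurability and integrability on `(0, 2]`
  have hAm : Measurable A := (monotone_strip hw).measurable
  have hAnm : Measurable An := (monotone_strip hwn).measurable
  have hDm : Measurable D := (weilIncrement_continuous hw).measurable
  have hψm : Measurable fun t : ℝ ↦ 1 / (2 * t) := (measurable_const.mul measurable_id).const_div 1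
  have hMint : IntegrableOn (fun t ↦ D t / (2 * t)) (Ioc 0 2) := integrableOn_jumpForm hw 2
  have hDint : IntegrableOn D (Ioc 0 2) :=
    (weilIncrement_continuous hw).integrableOn_Icc.mono_set Ioc_subset_Icc_self
  have dom : ∀ {f F : ℝ → ℝ}, Measurable f → IntegrableOn F (Ioc 0 2) →
      (∀ t ∈ Ioc (0 : ℝ) 2, 0 ≤ f t ∧ f t ≤ F t) → IntegrableOn f (Ioc 0 2) := by
    intro f F hf hF hb
    refine Integrable.mono' hF hf.aestronglyMeasurable ?_
    refine (ae_restrict_iff' measurableSet_Ioc).2 (Eventually.of_forall fun t ht ↦ ?_)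
    rw [Real.norm_of_nonneg (hb t ht).1]
    exact (hb t ht).2
  have hψA : IntegrableOn (fun t ↦ 1 / (2 * t) * A t) (Ioc 0 2) := by
    refine dom (hψm.mul hAm) hMint fun t ht ↦ ⟨mul_nonneg (by have := ht.1; positivity) (hA0 t), ?_⟩
    rw [hdec t, show 1 / (2 * t) * A t = A t / (2 * t) by ring]
    exact div_le_div_of_nonneg_right (by linarith [hAn0 t, hC0 t]) (by linarith [ht.1])
  have hψAn : IntegrableOn (fun t ↦ 1 / (2 * t) * An t) (Ioc 0 2) := by
    refine dom (hψm.mul hAnm) hMint fun t ht ↦ ⟨mul_nonneg (by have := ht.1; positivity) (hAn0 t), ?_⟩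
    rw [hdec t, show 1 / (2 * t) * An t = An t / (2 * t) by ring]
    exact div_le_div_of_nonneg_right (by linarith [hA0 t, hC0 t]) (by linarith [ht.1])
  have hA1 : IntegrableOn (fun t ↦ (fun _ : ℝ ↦ (1 : ℝ)) t * A t) (Ioc 0 2) := by
    refine dom (measurable_const.mul hAm) hDint fun t _ ↦ ⟨by simp only [one_mul]; exact hA0 t, ?_⟩
    rw [hdec t, one_mul]
    linarith [hAn0 t, hC0 t]
  have hAn1 : IntegrableOn (fun t ↦ (fun _ : ℝ ↦ (1 : ℝ)) t * An t) (Ioc 0 2) := by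
    refine dom (measurable_const.mul hAnm) hDint fun t _ ↦ ⟨by simp only [one_mul]; exact hAn0 t, ?_⟩
    rw [hdec t, one_mul]
    linarith [hA0 t, hC0 t]
  have hC4 : IntegrableOn (fun t ↦ C t / 4) (Ioc 0 2) := by
    have h : IntegrableOn (fun t ↦ (D t - A t - An t) / 4) (Ioc 0 2) := by
      refine dom ((hDm.sub hAm |>.sub hAnm).div_const 4) hMint fun t ht ↦ ?_
      rw [hdec t, show (A t + An t + C t - A t - An t) / 4 = C t / 4 by ring, add_div, add_div]
      refine ⟨div_nonneg (hC0 t) (by norm_num), ?_⟩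
      have h1 : C t / 4 ≤ C t / (2 * t) :=
        div_le_div_of_nonneg_left (hC0 t) (by linarith [ht.1]) (by linarith [ht.2])
      have h2 : 0 ≤ A t / (2 * t) := div_nonneg (hA0 t) (by linarith [ht.1])
      have h3 : 0 ≤ An t / (2 * t) := div_nonneg (hAn0 t) (by linarith [ht.1])
      linarith
    exact h.congr_fun (fun t _ ↦ by simp only; rw [hdec t]; ring) measurableSet_Ioc
  -- Step 1: `M ≥ ∫ (ψ A + ψ An + C/4)`
  have step1 : (∫ t in Ioc 0 2, (1 / (2 * t) * A t + 1 / (2 * t) * An t + C t / 4)) ≤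
      ∫ t in Ioc 0 2, D t / (2 * t) := by
    refine setIntegral_mono_on ((hψA.add hψAn).add hC4) hMint measurableSet_Ioc fun t ht ↦ ?_
    rw [hdec t, add_div, add_div]
    have h1 : C t / 4 ≤ C t / (2 * t) :=
      div_le_div_of_nonneg_left (hC0 t) (by linarith [ht.1]) (by linarith [ht.2])
    have e1 : 1 / (2 * t) * A t = A t / (2 * t) := by ring
    have e2 : 1 / (2 * t) * An t = An t / (2 * t) := by ring
    linarith
  have step2 : (∫ t in Ioc 0 2, (1 / (2 * t) * A t + 1 / (2 * t) * An t + C t / 4)) =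
      (∫ t in Ioc 0 2, 1 / (2 * t) * A t) + (∫ t in Ioc 0 2, 1 / (2 * t) * An t) +
        ∫ t in Ioc 0 2, C t / 4 := by
    have hψAAn : IntegrableOn (fun t ↦ 1 / (2 * t) * A t + 1 / (2 * t) * An t) (Ioc 0 2) :=
      hψA.add hψAn
    rw [integral_add hψAAn hC4, integral_add hψA hψAn]
  -- Step 2: the strips (Fubini with `ψ₁ = 1/(2t)` and `ψ₀ = 1`)
  have hψ0 : ∀ t ∈ Ioc (0 : ℝ) 2, 0 ≤ 1 / (2 * t) := fun t ht ↦ by have := ht.1; positivity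
  obtain ⟨hT, hTi⟩ := integral_weight_mul_strip hw hws hψm hψ0 hψA
  obtain ⟨hTn, hTni⟩ := integral_weight_mul_strip hwn hwns hψm hψ0 hψAn
  have h10 : ∀ t ∈ Ioc (0 : ℝ) 2, 0 ≤ (fun _ : ℝ ↦ (1 : ℝ)) t := fun _ _ ↦ zero_le_one
  obtain ⟨hS0, hS0i⟩ := integral_weight_mul_strip hw hws measurable_const h10 hA1
  obtain ⟨hSn0, hSn0i⟩ := integral_weight_mul_strip hwn hwns measurable_const h10 hAn1
  -- pointwise evaluation of the weights against `|w(u)|²`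
  have hzero : ∀ u, u ∉ Ioo (-1 : ℝ) 1 → w u = 0 := fun u hu ↦ eq_zero_of_not_mem_Ioo_one hw hws hu
  have ev1 : ∀ u, ‖w u‖ ^ 2 * (∫ t in Icc (u + 1) 2, 1 / (2 * t)) =
      ‖w u‖ ^ 2 * (1 / 2 * (Real.log 2 - Real.log (u + 1))) := by
    intro u
    by_cases hu : u ∈ Ioo (-1 : ℝ) 1
    · rw [integral_Icc_one_div_two_mul hu.1 hu.2.le]
    · rw [hzero u hu]; simp
  have ev1n : ∀ u, ‖wn u‖ ^ 2 * (∫ t in Icc (u + 1) 2, 1 / (2 * t)) =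
      ‖w (-u)‖ ^ 2 * (1 / 2 * (Real.log 2 - Real.log (u + 1))) := by
    intro u
    simp only [hwn_def]
    by_cases hu : u ∈ Ioo (-1 : ℝ) 1
    · rw [integral_Icc_one_div_two_mul hu.1 hu.2.le]
    · rw [hzero (-u) (fun h ↦ hu ⟨by linarith [h.2], by linarith [h.1]⟩)]; simp
  have ev0 : ∀ u, ‖w u‖ ^ 2 * (∫ t in Icc (u + 1) 2, (fun _ : ℝ ↦ (1 : ℝ)) t) =
      ‖w u‖ ^ 2 * (1 - u) := by
    intro u
    by_cases hu : u ∈ Ioo (-1 : ℝ) 1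
    · rw [setIntegral_const, Real.volume_real_Icc_of_le (by linarith [hu.2]), smul_eq_mul, mul_one]
      ring
    · rw [hzero u hu]; simp
  have ev0n : ∀ u, ‖wn u‖ ^ 2 * (∫ t in Icc (u + 1) 2, (fun _ : ℝ ↦ (1 : ℝ)) t) =
      ‖w (-u)‖ ^ 2 * (1 - u) := by
    intro u
    simp only [hwn_def]
    by_cases hu : u ∈ Ioo (-1 : ℝ) 1
    · rw [setIntegral_const, Real.volume_real_Icc_of_le (by linarith [hu.2]), smul_eq_mul, mul_one]
      ring
    · rw [hzero (-u) (fun h ↦ hu ⟨by linarith [h.2], by linarith [h.1]⟩)]; simp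
  -- integrability of the evaluated weights
  have hcs2 : HasCompactSupport fun u : ℝ ↦ ‖w u‖ ^ 2 :=
    hw.2.norm.comp_left (g := fun r : ℝ ↦ r ^ 2) (zero_pow two_ne_zero)
  have hint_poly : ∀ {h : ℝ → ℝ}, Continuous h → Integrable fun u ↦ ‖w u‖ ^ 2 * h u :=
    fun hh ↦ ((hwc.norm.pow 2).mul hh).integrable_of_hasCompactSupport hcs2.mul_right
  -- the `ψ₀`-strips sum to `2N`
  have hstrip0 : (∫ u, ‖w u‖ ^ 2 * ∫ t in Icc (u + 1) 2, (fun _ : ℝ ↦ (1 : ℝ)) t) +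
      (∫ u, ‖wn u‖ ^ 2 * ∫ t in Icc (u + 1) 2, (fun _ : ℝ ↦ (1 : ℝ)) t) = 2 * N := by
    simp_rw [ev0, ev0n]
    rw [show (∫ u, ‖w (-u)‖ ^ 2 * (1 - u)) = ∫ u, ‖w u‖ ^ 2 * (1 + u) from ?_]
    · rw [← integral_add (hint_poly (h := fun u : ℝ ↦ 1 - u) (by fun_prop))
        (hint_poly (h := fun u : ℝ ↦ 1 + u) (by fun_prop)), hN, ← integral_const_mul]
      congr 1 with u
      ring
    · rw [← integral_neg_eq_self (fun u ↦ ‖w u‖ ^ 2 * (1 + u)) volume]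
      refine integral_congr_ae (Eventually.of_forall fun u ↦ ?_)
      ring
  -- the `ψ₁`-strips dominate `log 2 · N + U/2`
  have hstrip1 : Real.log 2 * N + U / 2 ≤
      (∫ u, ‖w u‖ ^ 2 * ∫ t in Icc (u + 1) 2, 1 / (2 * t)) +
        ∫ u, ‖wn u‖ ^ 2 * ∫ t in Icc (u + 1) 2, 1 / (2 * t) := by
    have hTi' : Integrable fun u ↦ ‖w u‖ ^ 2 * (1 / 2 * (Real.log 2 - Real.log (u + 1))) := by
      simpa only [ev1] using hTi
    have hTni' : Integrable fun u ↦ ‖w (-u)‖ ^ 2 * (1 / 2 * (Real.log 2 - Real.log (u + 1))) := by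
      simpa only [ev1n] using hTni
    have hTni'' : Integrable fun u ↦ ‖w u‖ ^ 2 * (1 / 2 * (Real.log 2 - Real.log (-u + 1))) := by
      have := hTni'.comp_neg
      simpa only [neg_neg] using this
    simp_rw [ev1, ev1n]
    rw [show (∫ u, ‖w (-u)‖ ^ 2 * (1 / 2 * (Real.log 2 - Real.log (u + 1)))) =
        ∫ u, ‖w u‖ ^ 2 * (1 / 2 * (Real.log 2 - Real.log (-u + 1))) from ?_]
    · rw [← integral_add hTi' hTni'']
      have hx2 : Integrable fun u : ℝ ↦ u ^ 2 * ‖w u‖ ^ 2 := by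
        have := hint_poly (h := fun u : ℝ ↦ u ^ 2) (by fun_prop)
        simpa only [mul_comm] using this
      have lhs : ∫ u, ‖w u‖ ^ 2 * (Real.log 2 + u ^ 2 / 2) = Real.log 2 * N + U / 2 := by
        have e : (fun u : ℝ ↦ ‖w u‖ ^ 2 * (Real.log 2 + u ^ 2 / 2)) =
            fun u ↦ Real.log 2 * ‖w u‖ ^ 2 + 1 / 2 * (u ^ 2 * ‖w u‖ ^ 2) := by
          funext u
          ring
        rw [e, integral_add (hw.integrable_norm_sq.const_mul _) (hx2.const_mul _),
          integral_const_mul, integral_const_mul, hN, hU]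
        ring
      rw [← lhs]
      refine integral_mono (hint_poly (h := fun u : ℝ ↦ Real.log 2 + u ^ 2 / 2) (by fun_prop))
        (hTi'.add hTni'') fun u ↦ ?_
      simp only
      by_cases hu : u ∈ Ioo (-1 : ℝ) 1
      · rw [← mul_add]
        exact mul_le_mul_of_nonneg_left (strip_weight_ge hu) (by positivity)
      · rw [hzero u hu]
        simp
    · rw [← integral_neg_eq_self (fun u ↦ ‖w u‖ ^ 2 * (1 / 2 * (Real.log 2 - Real.log (-u + 1))))
        volume]
      congr 1 with u
      rw [neg_neg]
  -- Step 3: the bulk, `¼ ∫ C = ¼ (4N − |∫w|² − 2N)`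
  have hbulk : ∫ t in Ioc 0 2, C t / 4 = (2 * N - ‖∫ x, w x‖ ^ 2) / 4 := by
    rw [integral_div]
    congr 1
    have e : ∫ t in Ioc 0 2, C t =
        ∫ t in Ioc 0 2, (D t - (fun _ : ℝ ↦ (1 : ℝ)) t * A t - (fun _ : ℝ ↦ (1 : ℝ)) t * An t) :=
      setIntegral_congr_fun measurableSet_Ioc fun t _ ↦ by simp only; rw [hdec t]; ring
    have hDA : IntegrableOn (fun t ↦ D t - (fun _ : ℝ ↦ (1 : ℝ)) t * A t) (Ioc 0 2) :=
      hDint.sub hA1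
    rw [e, integral_sub hDA hAn1, integral_sub hDint hA1, hS0, hSn0,
      integral_Ioc_weilIncrement hw hws]
    linarith [hstrip0]
  -- Step 4: combine
  have hmean := norm_sq_integral_le_five_thirds hw hws
  rw [← hU] at hmean
  have : (Real.log 2 + 1 / 12) * N ≤
      (∫ t in Ioc 0 2, 1 / (2 * t) * A t) + (∫ t in Ioc 0 2, 1 / (2 * t) * An t) +
        ∫ t in Ioc 0 2, C t / 4 := by
    rw [hT, hTn, hbulk]
    nlinarith [hstrip1, hmean, hU0]
  linarith [step1, step2]

end LowerBound


/-! ## Assembly: Suzuki's Theorem 1.4, asymptotic part -/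

/-- **Suzuki 2026, Thm. 1.4 (asymptotic part)**, proved: there is `μ₁ > 0` (here
`μ₁ = ν − log 2` with `ν = inf {M_1(w) : w ∈ C_c^∞(−1,1), ‖w‖₂ = 1} ≥ log 2 + 1/12`,
`M_1(w) = ∫_{(0,2]} D_t(w) dt/(2t) = 𝓛(w) + (log 2)‖w‖²`, i.e. `μ₁ = inf 𝓛` as in §5.1) such that
`|λ_a − (log(1/a) + μ₁ − log 2π − γ)| ≤ 29 a` for `0 < a ≤ 1/4`, `λ_a = weilGroundEnergy a`.
Proof as in Suzuki §4.2–§5.1: the Rayleigh quotient of the window `[-a,a]` is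
`log(1/a) − log 4π − γ + M_a(g)/‖g‖² + O(a)` (`abs_weilQuadratic_re_sub_jumpForm_le`), the jump form
is dilation covariant (`M_a(g) = M_1(g_{a-1})`, `jumpForm_weilDilate_window`), so the infimum over
the window is `log(1/a) − log 4π − γ + ν + O(a)`; the positivity `μ₁ > 0` is Suzuki's compactness
claim `inf 𝓛̄ > 0`, replaced by the explicit bound `jumpForm_window_one_ge`.
[cite: Suzuki2026, Thm. 1.4; §4.2 (EQ_405), §5.1 (EQ_501)] -/
theorem Suzuki2026_thm_1_4_asymptotic_holds : Suzuki2026_thm_1_4_asymptotic := by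
  -- the scale-free infimum `ν`
  set S₁ : Set ℝ := {x : ℝ | ∃ w : ℝ → ℂ, IsWeilTest w ∧ tsupport w ⊆ Icc (-1) 1 ∧
    ∫ t : ℝ, ‖w t‖ ^ 2 = (1 : ℝ) ∧ x = ∫ t in Ioc 0 2, weilIncrement w t / (2 * t)} with hS₁
  have hS₁_ne : S₁.Nonempty := by
    obtain ⟨w, hw, hws, hw1⟩ := exists_isWeilTest_sphere one_pos
    exact ⟨_, w, hw, hws, hw1, rfl⟩
  have hS₁_lb : ∀ x ∈ S₁, Real.log 2 + 1 / 12 ≤ x := by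
    rintro x ⟨w, hw, hws, hw1, rfl⟩
    have h := jumpForm_window_one_ge hw hws
    rw [hw1, mul_one] at h
    exact h
  have hS₁_bdd : BddBelow S₁ := ⟨_, hS₁_lb⟩
  set ν : ℝ := sInf S₁ with hν
  have hν_lb : Real.log 2 + 1 / 12 ≤ ν := le_csInf hS₁_ne hS₁_lb
  have hν_le : ∀ x ∈ S₁, ν ≤ x := fun x hx ↦ csInf_le hS₁_bdd hx
  refine ⟨ν - Real.log 2, by linarith, 29, 1 / 4, by norm_num, fun a ha0 ha4 ↦ ?_⟩
  have hlog4 : Real.log (4 * π) = Real.log 2 + Real.log (2 * π) := by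
    rw [show (4 : ℝ) * π = 2 * (2 * π) by ring, Real.log_mul two_ne_zero (by positivity)]
  -- the unit sphere of the window
  set Sa : Set ℝ := {x : ℝ | ∃ g : ℝ → ℂ, IsWeilTest g ∧ tsupport g ⊆ Icc (-a) a ∧
    ∫ t : ℝ, ‖g t‖ ^ 2 = 1 ∧ x = (weilQuadratic g).re} with hSa
  have hSa_ne : Sa.Nonempty := by
    obtain ⟨g, hg, hgs, hg1⟩ := exists_isWeilTest_sphere ha0
    exact ⟨_, g, hg, hgs, hg1, rfl⟩
  have hSa_bdd : BddBelow Sa := bddBelow_weilQuadratic_sphere_holds a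
  have hE : weilGroundEnergy a = sInf Sa := rfl
  -- lower bound on the sphere
  have hlow : ∀ x ∈ Sa, Real.log (1 / a) + (ν - Real.log 2) - Real.log (2 * π) -
      Real.eulerMascheroniConstant - 29 * a ≤ x := by
    rintro x ⟨g, hg, hgs, hg1, rfl⟩
    have hkey := abs_weilQuadratic_re_sub_jumpForm_le hg ha0 ha4 hgs
    simp only [hg1, mul_one] at hkey
    have hM : (∫ t in Ioc 0 (2 * a), weilIncrement g t / (2 * t)) ∈ S₁ := by
      refine ⟨weilDilate (a - 1) g, hg.weilDilate (by linarith), tsupport_weilDilate_window ha0 hgs,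
        ?_, ?_⟩
      · rw [integral_norm_sq_weilDilate g (by linarith), hg1]
      · rw [jumpForm_weilDilate_window g ha0]
    have hνM := hν_le _ hM
    have h := (abs_le.1 hkey).1
    rw [hlog4] at h
    linarith
  -- near-minimisers of the scale-free form, moved to the window
  have hup : ∀ ε, 0 < ε → sInf Sa < Real.log (1 / a) + (ν - Real.log 2) - Real.log (2 * π) -
      Real.eulerMascheroniConstant + 29 * a + ε := by
    intro ε hε
    obtain ⟨x, hx, hxlt⟩ := exists_lt_of_csInf_lt hS₁_ne (lt_add_of_pos_right ν hε)
    obtain ⟨w, hw, hws, hw1, rfl⟩ := hx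
    have hη : -1 < 1 / a - 1 := by have := one_div_pos.2 ha0; linarith
    have hg : IsWeilTest (weilDilate (1 / a - 1) w) := hw.weilDilate hη
    have hgs : tsupport (weilDilate (1 / a - 1) w) ⊆ Icc (-a) a :=
      tsupport_weilDilate_window' ha0 hws
    have hg1 : ∫ t, ‖weilDilate (1 / a - 1) w t‖ ^ 2 = 1 := by
      rw [integral_norm_sq_weilDilate w hη, hw1]
    have hkey := abs_weilQuadratic_re_sub_jumpForm_le hg ha0 ha4 hgs
    simp only [hg1, mul_one, jumpForm_weilDilate_window' w ha0] at hkey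
    have hmem : (weilQuadratic (weilDilate (1 / a - 1) w)).re ∈ Sa := ⟨_, hg, hgs, hg1, rfl⟩
    have h1 := csInf_le hSa_bdd hmem
    have h := (abs_le.1 hkey).2
    rw [hlog4] at h
    linarith
  -- conclude
  rw [hE, abs_le]
  constructor
  · have h := le_csInf hSa_ne hlow
    linarith
  · have h : sInf Sa ≤ Real.log (1 / a) + (ν - Real.log 2) - Real.log (2 * π) -
        Real.eulerMascheroniConstant + 29 * a :=
      le_of_forall_pos_lt_add fun ε hε ↦ hup ε hε
    linarith

end Literature.NumberTheory.LFunctions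

end
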